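import Literature.Analysis.FunctionSpaces.TorusDerivSizeBounds
import Literature.Analysis.FluidPDE.CompressibleEulerLinearizedDerivative
import HarnessLib

/-!
# Pointwise bounds for the commutator residuals of the differentiated Euler system

Analysis/FluidPDE support file (everything proved; no named facts), part of the programme
proving `Literature.Analysis.FluidPDE.CompressibleEulerLocalWellPosedness` (Majda 1984,
Thms 2.1–2.2). When the symmetrised Euler system in primitive variables is differentiated in
space (`CompressibleEulerLinearizedDerivative.partialDeriv_res₁/₂/₃`), the derivatives
`∂^α(ρ, u, ϑ)`, `|α| ≤ 3`, satisfy the linearised system up to residuals built from the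
zeroth-order terms

  `T₁(r, w)ⱼ = ∑ᵢ (∂ⱼv)ᵢ ∂ᵢr + ∂ⱼc div w`                       (`tcont v c r w j`),
  `T₂(r, θ, w)ⱼ = ∑ᵢ (∂ⱼv)ᵢ ∂ᵢw + ∂ⱼa ∇r + ∂ⱼb ∇θ`            (`tmom v a b r θ w j`)

and their first and second space derivatives (Majda 1984, Ch. 2 §2.1, proof of Thm 2.1: the
commutator terms; Thm 2.2). This file bounds these quantities POINTWISE by sums of products
"(derivative of a coefficient) × (derivative size of a field)" (`abs_tcont_le`,
`abs_partialDeriv_tcont_le`, `abs_partialDeriv₂_tcont_le`, `norm_tmom_le`,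
`norm_partialDeriv_tmom_le`, `norm_partialDeriv₂_tmom_le`), in terms of the derivative sizes
`Torus.dsize₁/₂/₃` of scalars (`TorusDerivSizeBounds`) and `vsize₁/₂/₃` of vector fields, and
then, for coefficients `v = u`, `c = ρ` and `a, b, g` obeying `Torus.HasDerivBoundsAt₃` with a
constant `C` (`CompressibleEulerCoefficientBounds`) and first derivatives of `(ρ, u, ϑ)` bounded
by `M₁`, by `K`, `K(1 + s₂)`, `K(1 + s₂ + s₃ + s₂²)` at levels 1, 2, 3 (`level₁/₂/₃` lemmas),
`s₂, s₃` the total second/third derivative sizes of `(ρ, u, ϑ)` at the point and `K` explicit in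
`C, M₁, |d|`.

## References

* A. Majda, *Compressible Fluid Flow and Systems of Conservation Laws in Several Space
  Variables*, Springer 1984, Ch. 2 §2.1, Prop. 2.1, proof of Thm 2.1, Thm 2.2. [`Majda1984`]
-/

noncomputable section

open Set Function
open scoped ContDiff

namespace Literature.Analysis.FluidPDE

namespace CompressibleEuler

open Literature.Analysis.FunctionSpaces FunctionSpaces.Torus

variable {d : Type*} [Fintype d] [DecidableEq d]

/-! ## Derivative sizes of vector fields; gradient and divergence against sizes -/

section Sizes

/-- First-derivative size `∑ᵢ ‖∂ᵢu(x)‖` of a vector field at a point. [folklore] -/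
def vsize₁ (u : UnitAddTorus d → EuclideanSpace ℝ d) (x : UnitAddTorus d) : ℝ := ∑ i, ‖partialDeriv i u x‖

/-- Second-derivative size `∑ᵢⱼ ‖∂ⱼ∂ᵢu(x)‖`. [folklore] -/
def vsize₂ (u : UnitAddTorus d → EuclideanSpace ℝ d) (x : UnitAddTorus d) : ℝ := ∑ i, ∑ j, ‖partialDeriv j (partialDeriv i u) x‖

/-- Third-derivative size `∑ᵢⱼₖ ‖∂ₖ∂ⱼ∂ᵢu(x)‖`. [folklore] -/
def vsize₃ (u : UnitAddTorus d → EuclideanSpace ℝ d) (x : UnitAddTorus d) : ℝ :=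
  ∑ i, ∑ j, ∑ k, ‖partialDeriv k (partialDeriv j (partialDeriv i u)) x‖

/-- Sizes are nonnegative. [folklore] -/
theorem vsize₁_nonneg (u : UnitAddTorus d → EuclideanSpace ℝ d) (x : UnitAddTorus d) : 0 ≤ vsize₁ u x :=
  Finset.sum_nonneg fun _ _ => norm_nonneg _

/-- Sizes are nonnegative. [folklore] -/
theorem vsize₂_nonneg (u : UnitAddTorus d → EuclideanSpace ℝ d) (x : UnitAddTorus d) : 0 ≤ vsize₂ u x :=
  Finset.sum_nonneg fun _ _ => Finset.sum_nonneg fun _ _ => norm_nonneg _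

/-- Sizes are nonnegative. [folklore] -/
theorem vsize₃_nonneg (u : UnitAddTorus d → EuclideanSpace ℝ d) (x : UnitAddTorus d) : 0 ≤ vsize₃ u x :=
  Finset.sum_nonneg fun _ _ => Finset.sum_nonneg fun _ _ => Finset.sum_nonneg fun _ _ => norm_nonneg _

/-- A single first derivative is bounded by the size. [folklore] -/
theorem norm_partialDeriv_le_vsize₁ (u : UnitAddTorus d → EuclideanSpace ℝ d) (x : UnitAddTorus d) (i : d) :
    ‖partialDeriv i u x‖ ≤ vsize₁ u x :=
  Finset.single_le_sum (f := fun i => ‖partialDeriv i u x‖) (fun _ _ => norm_nonneg _) (Finset.mem_univ i)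

/-- A single second derivative is bounded by the size. [folklore] -/
theorem norm_partialDeriv₂_le_vsize₂ (u : UnitAddTorus d → EuclideanSpace ℝ d) (x : UnitAddTorus d) (i j : d) :
    ‖partialDeriv j (partialDeriv i u) x‖ ≤ vsize₂ u x := by
  refine le_trans ?_ (Finset.single_le_sum (f := fun i => ∑ j, ‖partialDeriv j (partialDeriv i u) x‖)
    (fun _ _ => Finset.sum_nonneg fun _ _ => norm_nonneg _) (Finset.mem_univ i))
  exact Finset.single_le_sum (f := fun j => ‖partialDeriv j (partialDeriv i u) x‖) (fun _ _ => norm_nonneg _)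
    (Finset.mem_univ j)

/-- A single third derivative is bounded by the size. [folklore] -/
theorem norm_partialDeriv₃_le_vsize₃ (u : UnitAddTorus d → EuclideanSpace ℝ d) (x : UnitAddTorus d) (i j k : d) :
    ‖partialDeriv k (partialDeriv j (partialDeriv i u)) x‖ ≤ vsize₃ u x := by
  refine le_trans ?_ (Finset.single_le_sum
    (f := fun i => ∑ j, ∑ k, ‖partialDeriv k (partialDeriv j (partialDeriv i u)) x‖)
    (fun _ _ => Finset.sum_nonneg fun _ _ => Finset.sum_nonneg fun _ _ => norm_nonneg _) (Finset.mem_univ i))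
  refine le_trans ?_ (Finset.single_le_sum
    (f := fun j => ∑ k, ‖partialDeriv k (partialDeriv j (partialDeriv i u)) x‖)
    (fun _ _ => Finset.sum_nonneg fun _ _ => norm_nonneg _) (Finset.mem_univ j))
  exact Finset.single_le_sum (f := fun k => ‖partialDeriv k (partialDeriv j (partialDeriv i u)) x‖)
    (fun _ _ => norm_nonneg _) (Finset.mem_univ k)

/-- Sub-sums, scalar: `dsize₁ (∂ₖr) ≤ dsize₂ r`. [folklore] -/
theorem dsize₁_partialDeriv_le {r : UnitAddTorus d → ℝ} (hr : IsSmooth r) (x : UnitAddTorus d) (k : d) :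
    dsize₁ (partialDeriv k r) x ≤ dsize₂ r x := by
  simp only [dsize₁, dsize₂]
  calc ∑ i, |partialDeriv i (partialDeriv k r) x| = ∑ i, |partialDeriv k (partialDeriv i r) x| :=
        Finset.sum_congr rfl fun i _ => by rw [partialDeriv_comm hr i k x]
    _ ≤ ∑ i, ∑ j, |partialDeriv j (partialDeriv i r) x| := Finset.sum_le_sum fun i _ =>
        Finset.single_le_sum (f := fun j => |partialDeriv j (partialDeriv i r) x|) (fun _ _ => abs_nonneg _)
          (Finset.mem_univ k)

/-- Sub-sums, scalar: `dsize₂ (∂ₖr) ≤ dsize₃ r`. [folklore] -/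
theorem dsize₂_partialDeriv_le {r : UnitAddTorus d → ℝ} (hr : IsSmooth r) (x : UnitAddTorus d) (k : d) :
    dsize₂ (partialDeriv k r) x ≤ dsize₃ r x := by
  simp only [dsize₂, dsize₃]
  calc ∑ i, ∑ j, |partialDeriv j (partialDeriv i (partialDeriv k r)) x|
        = ∑ i, ∑ j, |partialDeriv k (partialDeriv j (partialDeriv i r)) x| :=
        Finset.sum_congr rfl fun i _ => Finset.sum_congr rfl fun j _ => by
          have e : partialDeriv i (partialDeriv k r) = partialDeriv k (partialDeriv i r) :=
            funext fun y => partialDeriv_comm hr i k y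
          rw [e, partialDeriv_comm (hr.partialDeriv i) j k x]
    _ ≤ ∑ i, ∑ j, ∑ k', |partialDeriv k' (partialDeriv j (partialDeriv i r)) x| :=
        Finset.sum_le_sum fun i _ => Finset.sum_le_sum fun j _ =>
          Finset.single_le_sum (f := fun k' => |partialDeriv k' (partialDeriv j (partialDeriv i r)) x|)
            (fun _ _ => abs_nonneg _) (Finset.mem_univ k)

/-- Sub-sums, scalar: `dsize₁ (∂ₖ∂ⱼr) ≤ dsize₃ r`. [folklore] -/
theorem dsize₁_partialDeriv₂_le {r : UnitAddTorus d → ℝ} (hr : IsSmooth r) (x : UnitAddTorus d) (j k : d) :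
    dsize₁ (partialDeriv k (partialDeriv j r)) x ≤ dsize₃ r x :=
  (dsize₁_partialDeriv_le (hr.partialDeriv j) x k).trans (dsize₂_partialDeriv_le hr x j)

/-- Sub-sums, vector: `vsize₁ (∂ₖw) ≤ vsize₂ w`. [folklore] -/
theorem vsize₁_partialDeriv_le {w : UnitAddTorus d → EuclideanSpace ℝ d} (hw : IsSmooth w) (x : UnitAddTorus d) (k : d) :
    vsize₁ (partialDeriv k w) x ≤ vsize₂ w x := by
  simp only [vsize₁, vsize₂]
  calc ∑ i, ‖partialDeriv i (partialDeriv k w) x‖ = ∑ i, ‖partialDeriv k (partialDeriv i w) x‖ :=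
        Finset.sum_congr rfl fun i _ => by rw [partialDeriv_comm hw i k x]
    _ ≤ ∑ i, ∑ j, ‖partialDeriv j (partialDeriv i w) x‖ := Finset.sum_le_sum fun i _ =>
        Finset.single_le_sum (f := fun j => ‖partialDeriv j (partialDeriv i w) x‖) (fun _ _ => norm_nonneg _)
          (Finset.mem_univ k)

/-- Sub-sums, vector: `vsize₂ (∂ₖw) ≤ vsize₃ w`. [folklore] -/
theorem vsize₂_partialDeriv_le {w : UnitAddTorus d → EuclideanSpace ℝ d} (hw : IsSmooth w) (x : UnitAddTorus d) (k : d) :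
    vsize₂ (partialDeriv k w) x ≤ vsize₃ w x := by
  simp only [vsize₂, vsize₃]
  calc ∑ i, ∑ j, ‖partialDeriv j (partialDeriv i (partialDeriv k w)) x‖
        = ∑ i, ∑ j, ‖partialDeriv k (partialDeriv j (partialDeriv i w)) x‖ :=
        Finset.sum_congr rfl fun i _ => Finset.sum_congr rfl fun j _ => by
          have e : partialDeriv i (partialDeriv k w) = partialDeriv k (partialDeriv i w) :=
            funext fun y => partialDeriv_comm hw i k y
          rw [e, partialDeriv_comm (hw.partialDeriv i) j k x]
    _ ≤ ∑ i, ∑ j, ∑ k', ‖partialDeriv k' (partialDeriv j (partialDeriv i w)) x‖ :=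
        Finset.sum_le_sum fun i _ => Finset.sum_le_sum fun j _ =>
          Finset.single_le_sum (f := fun k' => ‖partialDeriv k' (partialDeriv j (partialDeriv i w)) x‖)
            (fun _ _ => norm_nonneg _) (Finset.mem_univ k)

/-- Sub-sums, vector: `vsize₁ (∂ₖ∂ⱼw) ≤ vsize₃ w`. [folklore] -/
theorem vsize₁_partialDeriv₂_le {w : UnitAddTorus d → EuclideanSpace ℝ d} (hw : IsSmooth w) (x : UnitAddTorus d) (j k : d) :
    vsize₁ (partialDeriv k (partialDeriv j w)) x ≤ vsize₃ w x :=
  (vsize₁_partialDeriv_le (hw.partialDeriv j) x k).trans (vsize₂_partialDeriv_le hw x j)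

/-- `‖∇r(x)‖ ≤ dsize₁ r x`. [folklore] -/
theorem norm_gradient_le_dsize₁ {r : UnitAddTorus d → ℝ} (hr : IsSmooth r) (x : UnitAddTorus d) :
    ‖gradient r x‖ ≤ dsize₁ r x := by
  rw [gradient_eq_sum_partialDeriv (hr.isContDiff (by simp)) x, dsize₁]
  refine (norm_sum_le _ _).trans (Finset.sum_le_sum fun i _ => ?_)
  rw [norm_smul, Real.norm_eq_abs]
  have h1 : ‖EuclideanSpace.single i (1 : ℝ)‖ = 1 := by
    rw [EuclideanSpace.norm_eq]; simp [Finset.sum_ite_eq']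
  rw [h1, mul_one]

/-- `|div w(x)| ≤ vsize₁ w x`. [folklore] -/
theorem abs_divergence_le_vsize₁ {w : UnitAddTorus d → EuclideanSpace ℝ d} (hw : IsSmooth w) (x : UnitAddTorus d) :
    |divergence w x| ≤ vsize₁ w x := by
  rw [divergence, vsize₁]
  refine (Finset.abs_sum_le_sum_abs _ _).trans (Finset.sum_le_sum fun i _ => ?_)
  rw [partialDeriv_apply_coord (hw.isContDiff (by simp)) i x i, ← Real.norm_eq_abs]
  exact PiLp.norm_apply_le _ _

end Sizes

/-! ## Pointwise Leibniz bounds for scalar multiples of vector fields -/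

section Smul

variable {f : UnitAddTorus d → ℝ} {G : UnitAddTorus d → EuclideanSpace ℝ d} {x : UnitAddTorus d} {f₀ f₁ f₂ g₀ g₁ g₂ : ℝ}

omit [DecidableEq d] in
/-- Order zero: `‖p • q‖ ≤ f₀ g₀` when `|p| ≤ f₀`, `‖q‖ ≤ g₀`. [folklore] -/
theorem norm_smul_le₀ {p : ℝ} {q : EuclideanSpace ℝ d} (hf₀ : |p| ≤ f₀) (hg₀ : ‖q‖ ≤ g₀) :
    ‖p • q‖ ≤ f₀ * g₀ := by
  rw [norm_smul, Real.norm_eq_abs]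
  exact mul_le_mul hf₀ hg₀ (norm_nonneg _) ((abs_nonneg _).trans hf₀)

/-- Order one: `‖∂ₖ(f • G)(x)‖ ≤ f₀ g₁ + f₁ g₀`. [folklore] -/
theorem norm_partialDeriv_smul_le₁ (hf : IsSmooth f) (hG : IsSmooth G) (hf₀ : |f x| ≤ f₀)
    (hf₁ : ∀ i, |partialDeriv i f x| ≤ f₁) (hg₀ : ‖G x‖ ≤ g₀) (hg₁ : ∀ i, ‖partialDeriv i G x‖ ≤ g₁)
    (k : d) : ‖partialDeriv k (fun y => f y • G y) x‖ ≤ f₀ * g₁ + f₁ * g₀ := by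
  have h := partialDeriv_smul_sub hf hG k x
  have e : partialDeriv k (fun y => f y • G y) x = f x • partialDeriv k G x + partialDeriv k f x • G x := by
    rw [← h]; abel
  rw [e]
  refine (norm_add_le _ _).trans (add_le_add ?_ ?_)
  · rw [norm_smul, Real.norm_eq_abs]
    exact mul_le_mul hf₀ (hg₁ k) (norm_nonneg _) ((abs_nonneg _).trans hf₀)
  · rw [norm_smul, Real.norm_eq_abs]
    exact mul_le_mul (hf₁ k) hg₀ (norm_nonneg _) ((abs_nonneg _).trans (hf₁ k))

/-- Order two: `‖∂ₗ∂ₖ(f • G)(x)‖ ≤ f₀ g₂ + 2 f₁ g₁ + f₂ g₀`. [folklore] -/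
theorem norm_partialDeriv_smul_le₂ (hf : IsSmooth f) (hG : IsSmooth G) (hf₀ : |f x| ≤ f₀)
    (hf₁ : ∀ i, |partialDeriv i f x| ≤ f₁) (hf₂ : ∀ i j, |partialDeriv j (partialDeriv i f) x| ≤ f₂)
    (hg₀ : ‖G x‖ ≤ g₀) (hg₁ : ∀ i, ‖partialDeriv i G x‖ ≤ g₁)
    (hg₂ : ∀ i j, ‖partialDeriv j (partialDeriv i G) x‖ ≤ g₂) (k l : d) :
    ‖partialDeriv l (partialDeriv k (fun y => f y • G y)) x‖ ≤ f₀ * g₂ + 2 * (f₁ * g₁) + f₂ * g₀ := by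
  have h := partialDeriv₂_smul_sub hf hG k l x
  have e : partialDeriv l (partialDeriv k (fun y => f y • G y)) x =
      f x • partialDeriv l (partialDeriv k G) x + (partialDeriv l (partialDeriv k f) x • G x +
        partialDeriv k f x • partialDeriv l G x + partialDeriv l f x • partialDeriv k G x) := by
    rw [← h]; abel
  have n0 : 0 ≤ f₀ := (abs_nonneg _).trans hf₀
  have n1 : 0 ≤ f₁ := (abs_nonneg _).trans (hf₁ k)
  have n2 : 0 ≤ f₂ := (abs_nonneg _).trans (hf₂ k l)
  rw [e]
  have h1 : ‖f x • partialDeriv l (partialDeriv k G) x‖ ≤ f₀ * g₂ := by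
    rw [norm_smul, Real.norm_eq_abs]; exact mul_le_mul hf₀ (hg₂ k l) (norm_nonneg _) n0
  have h2 : ‖partialDeriv l (partialDeriv k f) x • G x‖ ≤ f₂ * g₀ := by
    rw [norm_smul, Real.norm_eq_abs]; exact mul_le_mul (hf₂ k l) hg₀ (norm_nonneg _) n2
  have h3 : ‖partialDeriv k f x • partialDeriv l G x‖ ≤ f₁ * g₁ := by
    rw [norm_smul, Real.norm_eq_abs]; exact mul_le_mul (hf₁ k) (hg₁ l) (norm_nonneg _) n1
  have h4 : ‖partialDeriv l f x • partialDeriv k G x‖ ≤ f₁ * g₁ := by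
    rw [norm_smul, Real.norm_eq_abs]; exact mul_le_mul (hf₁ l) (hg₁ k) (norm_nonneg _) n1
  have t1 := norm_add_le (f x • partialDeriv l (partialDeriv k G) x)
    (partialDeriv l (partialDeriv k f) x • G x + partialDeriv k f x • partialDeriv l G x +
      partialDeriv l f x • partialDeriv k G x)
  have t2 := norm_add₃_le (a := partialDeriv l (partialDeriv k f) x • G x)
    (b := partialDeriv k f x • partialDeriv l G x) (c := partialDeriv l f x • partialDeriv k G x)
  linarith

omit [Fintype d] [DecidableEq d] in
/-- Order zero, products: `|p q| ≤ f₀ g₀` when `|p| ≤ f₀`, `|q| ≤ g₀`. [folklore] -/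
theorem abs_mul_le₀ {p q : ℝ} (hf₀ : |p| ≤ f₀) (hg₀ : |q| ≤ g₀) : |p * q| ≤ f₀ * g₀ := by
  rw [abs_mul]; exact mul_le_mul hf₀ hg₀ (abs_nonneg _) ((abs_nonneg _).trans hf₀)

end Smul

/-! ## The zeroth-order terms `T₁`, `T₂` and their derivatives -/

section Terms

/-- The zeroth-order term of `∂ⱼ` of the linearised continuity/temperature equation:
`T₁(r, w)ⱼ = ∑ᵢ (∂ⱼv)ᵢ ∂ᵢr + ∂ⱼc div w` (`CompressibleEulerLinearizedDerivative.partialDeriv_res₁`).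
[cite: Majda1984, Ch. 2 §2.1, proof of Thm 2.1] -/
def tcont (v : UnitAddTorus d → EuclideanSpace ℝ d) (c r : UnitAddTorus d → ℝ) (w : UnitAddTorus d → EuclideanSpace ℝ d) (j : d) :
    UnitAddTorus d → ℝ :=
  fun x => (∑ i, partialDeriv j v x i * partialDeriv i r x) + partialDeriv j c x * divergence w x

/-- The zeroth-order term of `∂ⱼ` of the linearised momentum equation:
`T₂(r, θ, w)ⱼ = ∑ᵢ (∂ⱼv)ᵢ ∂ᵢw + ∂ⱼa ∇r + ∂ⱼb ∇θ` (`CompressibleEulerLinearizedDerivative.partialDeriv_res₂`).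
[cite: Majda1984, Ch. 2 §2.1, proof of Thm 2.1] -/
def tmom (v : UnitAddTorus d → EuclideanSpace ℝ d) (a b r θ : UnitAddTorus d → ℝ) (w : UnitAddTorus d → EuclideanSpace ℝ d) (j : d) :
    UnitAddTorus d → EuclideanSpace ℝ d :=
  fun x => (∑ i, partialDeriv j v x i • partialDeriv i w x) + partialDeriv j a x • gradient r x +
    partialDeriv j b x • gradient θ x

variable {v w : UnitAddTorus d → EuclideanSpace ℝ d} {a b c r θ : UnitAddTorus d → ℝ}

/-- Components of derivatives of a smooth field are smooth, with the expected derivatives. [folklore] -/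
theorem isSmooth_partialDeriv_apply (hv : IsSmooth v) (j i : d) : IsSmooth (fun y => partialDeriv j v y i) := by
  rw [partialDeriv_apply_coord_fun hv j i]; exact (hv.apply i).partialDeriv j

/-- `∂ₖ[(∂ⱼv)ᵢ](x) = (∂ₖ∂ⱼv(x))ᵢ`. [folklore] -/
theorem partialDeriv_partialDeriv_apply (hv : IsSmooth v) (j i k : d) (x : UnitAddTorus d) :
    partialDeriv k (fun y => partialDeriv j v y i) x = partialDeriv k (partialDeriv j v) x i :=
  partialDeriv_apply_coord ((hv.partialDeriv j).isContDiff (by simp)) k x i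

/-- `∂ₗ∂ₖ[(∂ⱼv)ᵢ](x) = (∂ₗ∂ₖ∂ⱼv(x))ᵢ`. [folklore] -/
theorem partialDeriv₂_partialDeriv_apply (hv : IsSmooth v) (j i k l : d) (x : UnitAddTorus d) :
    partialDeriv l (partialDeriv k (fun y => partialDeriv j v y i)) x =
      partialDeriv l (partialDeriv k (partialDeriv j v)) x i := by
  have e : partialDeriv k (fun y => partialDeriv j v y i) = fun y => partialDeriv k (partialDeriv j v) y i :=
    funext fun y => partialDeriv_partialDeriv_apply hv j i k y
  rw [e]
  exact partialDeriv_apply_coord (((hv.partialDeriv j).partialDeriv k).isContDiff (by simp)) l x i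

/-- `T₁` is smooth. [folklore] -/
theorem isSmooth_tcont (hv : IsSmooth v) (hc : IsSmooth c) (hr : IsSmooth r) (hw : IsSmooth w) (j : d) :
    IsSmooth (tcont v c r w j) := by
  have h1 : IsSmooth (fun y => ∑ i, partialDeriv j v y i * partialDeriv i r y) :=
    isSmooth_fun_sum _ fun i _ => (ContDiff.mul (isSmooth_partialDeriv_apply hv j i) (hr.partialDeriv i) :
      IsSmooth fun y => partialDeriv j v y i * partialDeriv i r y)
  have h2 : IsSmooth (fun y => partialDeriv j c y * divergence w y) :=
    (ContDiff.mul (hc.partialDeriv j) hw.divergence : IsSmooth fun y => partialDeriv j c y * divergence w y)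
  exact h1.add h2

/-- `T₂` is smooth. [folklore] -/
theorem isSmooth_tmom (hv : IsSmooth v) (ha : IsSmooth a) (hb : IsSmooth b) (hr : IsSmooth r) (hθ : IsSmooth θ)
    (hw : IsSmooth w) (j : d) : IsSmooth (tmom v a b r θ w j) := by
  have h1 : IsSmooth (fun y => ∑ i, partialDeriv j v y i • partialDeriv i w y) :=
    isSmooth_fun_sum _ fun i _ => (isSmooth_partialDeriv_apply hv j i).smul' (hw.partialDeriv i)
  exact (h1.add ((ha.partialDeriv j).smul' hr.gradient)).add ((hb.partialDeriv j).smul' hθ.gradient)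

/-- First derivative of `T₁` as a sum of derivatives of products. [folklore] -/
theorem partialDeriv_tcont (hv : IsSmooth v) (hc : IsSmooth c) (hr : IsSmooth r) (hw : IsSmooth w) (j k : d)
    (x : UnitAddTorus d) :
    partialDeriv k (tcont v c r w j) x =
      (∑ i, partialDeriv k (fun y => partialDeriv j v y i * partialDeriv i r y) x) +
        partialDeriv k (fun y => partialDeriv j c y * divergence w y) x := by
  have hs : ∀ i, IsSmooth (fun y => partialDeriv j v y i * partialDeriv i r y) := fun i =>
    (ContDiff.mul (isSmooth_partialDeriv_apply hv j i) (hr.partialDeriv i) :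
      IsSmooth fun y => partialDeriv j v y i * partialDeriv i r y)
  have h1 : IsSmooth (fun y => ∑ i, partialDeriv j v y i * partialDeriv i r y) := isSmooth_fun_sum _ fun i _ => hs i
  have h2 : IsSmooth (fun y => partialDeriv j c y * divergence w y) :=
    (ContDiff.mul (hc.partialDeriv j) hw.divergence : IsSmooth fun y => partialDeriv j c y * divergence w y)
  have e : tcont v c r w j = (fun y => ∑ i, partialDeriv j v y i * partialDeriv i r y) +
      fun y => partialDeriv j c y * divergence w y := rfl
  rw [e, partialDeriv_add (h1.isContDiff (by simp)) (h2.isContDiff (by simp)), Pi.add_apply,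
    partialDeriv_finset_sum _ (fun i _ => (hs i).isContDiff (by simp))]

/-- First derivative of `T₁` as a function. [folklore] -/
theorem partialDeriv_tcont_fun (hv : IsSmooth v) (hc : IsSmooth c) (hr : IsSmooth r) (hw : IsSmooth w) (j k : d) :
    partialDeriv k (tcont v c r w j) =
      (fun x => ∑ i, partialDeriv k (fun y => partialDeriv j v y i * partialDeriv i r y) x) +
        partialDeriv k (fun y => partialDeriv j c y * divergence w y) :=
  funext fun x => partialDeriv_tcont hv hc hr hw j k x

/-- Second derivative of `T₁` as a sum of second derivatives of products. [folklore] -/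
theorem partialDeriv₂_tcont (hv : IsSmooth v) (hc : IsSmooth c) (hr : IsSmooth r) (hw : IsSmooth w) (j k l : d)
    (x : UnitAddTorus d) :
    partialDeriv l (partialDeriv k (tcont v c r w j)) x =
      (∑ i, partialDeriv l (partialDeriv k (fun y => partialDeriv j v y i * partialDeriv i r y)) x) +
        partialDeriv l (partialDeriv k (fun y => partialDeriv j c y * divergence w y)) x := by
  have hs : ∀ i, IsSmooth (fun y => partialDeriv j v y i * partialDeriv i r y) := fun i =>
    (ContDiff.mul (isSmooth_partialDeriv_apply hv j i) (hr.partialDeriv i) :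
      IsSmooth fun y => partialDeriv j v y i * partialDeriv i r y)
  have h2 : IsSmooth (fun y => partialDeriv j c y * divergence w y) :=
    (ContDiff.mul (hc.partialDeriv j) hw.divergence : IsSmooth fun y => partialDeriv j c y * divergence w y)
  have h1' : IsSmooth (fun x => ∑ i, partialDeriv k (fun y => partialDeriv j v y i * partialDeriv i r y) x) :=
    isSmooth_fun_sum _ fun i _ => (hs i).partialDeriv k
  rw [partialDeriv_tcont_fun hv hc hr hw j k,
    partialDeriv_add (h1'.isContDiff (by simp)) ((h2.partialDeriv k).isContDiff (by simp)), Pi.add_apply,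
    partialDeriv_finset_sum _ (fun i _ => ((hs i).partialDeriv k).isContDiff (by simp))]

/-- First derivative of `T₂` as a sum of derivatives of products. [folklore] -/
theorem partialDeriv_tmom (hv : IsSmooth v) (ha : IsSmooth a) (hb : IsSmooth b) (hr : IsSmooth r) (hθ : IsSmooth θ)
    (hw : IsSmooth w) (j k : d) (x : UnitAddTorus d) :
    partialDeriv k (tmom v a b r θ w j) x =
      (∑ i, partialDeriv k (fun y => partialDeriv j v y i • partialDeriv i w y) x) +
        partialDeriv k (fun y => partialDeriv j a y • gradient r y) x +
        partialDeriv k (fun y => partialDeriv j b y • gradient θ y) x := by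
  have hs : ∀ i, IsSmooth (fun y => partialDeriv j v y i • partialDeriv i w y) := fun i =>
    (isSmooth_partialDeriv_apply hv j i).smul' (hw.partialDeriv i)
  have h1 : IsSmooth (fun y => ∑ i, partialDeriv j v y i • partialDeriv i w y) := isSmooth_fun_sum _ fun i _ => hs i
  have h2 : IsSmooth (fun y => partialDeriv j a y • gradient r y) := (ha.partialDeriv j).smul' hr.gradient
  have h3 : IsSmooth (fun y => partialDeriv j b y • gradient θ y) := (hb.partialDeriv j).smul' hθ.gradient
  have e : tmom v a b r θ w j = ((fun y => ∑ i, partialDeriv j v y i • partialDeriv i w y) +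
      fun y => partialDeriv j a y • gradient r y) + fun y => partialDeriv j b y • gradient θ y := rfl
  rw [e, partialDeriv_add ((h1.add h2).isContDiff (by simp)) (h3.isContDiff (by simp)),
    partialDeriv_add (h1.isContDiff (by simp)) (h2.isContDiff (by simp))]
  simp only [Pi.add_apply]
  rw [partialDeriv_finset_sum _ (fun i _ => (hs i).isContDiff (by simp))]

/-- First derivative of `T₂` as a function. [folklore] -/
theorem partialDeriv_tmom_fun (hv : IsSmooth v) (ha : IsSmooth a) (hb : IsSmooth b) (hr : IsSmooth r)
    (hθ : IsSmooth θ) (hw : IsSmooth w) (j k : d) :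
    partialDeriv k (tmom v a b r θ w j) =
      ((fun x => ∑ i, partialDeriv k (fun y => partialDeriv j v y i • partialDeriv i w y) x) +
        partialDeriv k (fun y => partialDeriv j a y • gradient r y)) +
        partialDeriv k (fun y => partialDeriv j b y • gradient θ y) :=
  funext fun x => partialDeriv_tmom hv ha hb hr hθ hw j k x

/-- Second derivative of `T₂` as a sum of second derivatives of products. [folklore] -/
theorem partialDeriv₂_tmom (hv : IsSmooth v) (ha : IsSmooth a) (hb : IsSmooth b) (hr : IsSmooth r) (hθ : IsSmooth θ)
    (hw : IsSmooth w) (j k l : d) (x : UnitAddTorus d) :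
    partialDeriv l (partialDeriv k (tmom v a b r θ w j)) x =
      (∑ i, partialDeriv l (partialDeriv k (fun y => partialDeriv j v y i • partialDeriv i w y)) x) +
        partialDeriv l (partialDeriv k (fun y => partialDeriv j a y • gradient r y)) x +
        partialDeriv l (partialDeriv k (fun y => partialDeriv j b y • gradient θ y)) x := by
  have hs : ∀ i, IsSmooth (fun y => partialDeriv j v y i • partialDeriv i w y) := fun i =>
    (isSmooth_partialDeriv_apply hv j i).smul' (hw.partialDeriv i)
  have h2 : IsSmooth (fun y => partialDeriv j a y • gradient r y) := (ha.partialDeriv j).smul' hr.gradient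
  have h3 : IsSmooth (fun y => partialDeriv j b y • gradient θ y) := (hb.partialDeriv j).smul' hθ.gradient
  have h1' : IsSmooth (fun x => ∑ i, partialDeriv k (fun y => partialDeriv j v y i • partialDeriv i w y) x) :=
    isSmooth_fun_sum _ fun i _ => (hs i).partialDeriv k
  rw [partialDeriv_tmom_fun hv ha hb hr hθ hw j k,
    partialDeriv_add ((h1'.add (h2.partialDeriv k)).isContDiff (by simp)) ((h3.partialDeriv k).isContDiff (by simp)),
    partialDeriv_add (h1'.isContDiff (by simp)) ((h2.partialDeriv k).isContDiff (by simp))]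
  simp only [Pi.add_apply]
  rw [partialDeriv_finset_sum _ (fun i _ => ((hs i).partialDeriv k).isContDiff (by simp))]

end Terms

/-! ## Generic pointwise bounds for `T₁`, `T₂` and their first two derivatives -/

section TBounds

variable {v w : UnitAddTorus d → EuclideanSpace ℝ d} {a b c r θ : UnitAddTorus d → ℝ} {x : UnitAddTorus d} {j : d}
  {pv₀ pv₁ pv₂ pc₀ pc₁ pc₂ pa₀ pa₁ pa₂ pb₀ pb₁ pb₂ : ℝ}

omit [DecidableEq d] in
/-- Components are bounded by the norm. [folklore] -/
theorem abs_apply_le_norm' (y : EuclideanSpace ℝ d) (i : d) : |y i| ≤ ‖y‖ := by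
  rw [← Real.norm_eq_abs]; exact PiLp.norm_apply_le y i

/-- First derivatives of the components `(∂ⱼv)ᵢ` at `x` are bounded by `‖∂ₖ∂ⱼv(x)‖`. [folklore] -/
theorem abs_partialDeriv_apply_le₁ (hv : IsSmooth v) (hv₁ : ∀ k, ‖partialDeriv k (partialDeriv j v) x‖ ≤ pv₁)
    (i k : d) : |partialDeriv k (fun y => partialDeriv j v y i) x| ≤ pv₁ := by
  rw [partialDeriv_partialDeriv_apply hv j i k x]; exact (abs_apply_le_norm' _ i).trans (hv₁ k)

/-- Second derivatives of the components `(∂ⱼv)ᵢ` at `x` are bounded by `‖∂ₗ∂ₖ∂ⱼv(x)‖`. [folklore] -/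
theorem abs_partialDeriv_apply_le₂ (hv : IsSmooth v)
    (hv₂ : ∀ k l, ‖partialDeriv l (partialDeriv k (partialDeriv j v)) x‖ ≤ pv₂) (i k l : d) :
    |partialDeriv l (partialDeriv k (fun y => partialDeriv j v y i)) x| ≤ pv₂ := by
  rw [partialDeriv₂_partialDeriv_apply hv j i k l x]; exact (abs_apply_le_norm' _ i).trans (hv₂ k l)

/-- Data for `div w`: values, first and second derivatives at `x` against the sizes. [folklore] -/
theorem divergence_data (hw : IsSmooth w) :
    |divergence w x| ≤ vsize₁ w x ∧ (∀ k, |partialDeriv k (divergence w) x| ≤ vsize₂ w x) ∧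
      ∀ k l, |partialDeriv l (partialDeriv k (divergence w)) x| ≤ vsize₃ w x := by
  refine ⟨abs_divergence_le_vsize₁ hw x, fun k => ?_, fun k l => ?_⟩
  · rw [partialDeriv_divergence_eq hw k x]
    exact (abs_divergence_le_vsize₁ (hw.partialDeriv k) x).trans (vsize₁_partialDeriv_le hw x k)
  · have e : partialDeriv k (divergence w) = divergence (partialDeriv k w) :=
      funext fun y => partialDeriv_divergence_eq hw k y
    rw [e, partialDeriv_divergence_eq (hw.partialDeriv k) l x]
    exact (abs_divergence_le_vsize₁ ((hw.partialDeriv k).partialDeriv l) x).trans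
      (vsize₁_partialDeriv₂_le hw x k l)

/-- Data for `∇r`: values, first and second derivatives at `x` against the sizes. [folklore] -/
theorem gradient_data (hr : IsSmooth r) :
    ‖gradient r x‖ ≤ dsize₁ r x ∧ (∀ k, ‖partialDeriv k (gradient r) x‖ ≤ dsize₂ r x) ∧
      ∀ k l, ‖partialDeriv l (partialDeriv k (gradient r)) x‖ ≤ dsize₃ r x := by
  refine ⟨norm_gradient_le_dsize₁ hr x, fun k => ?_, fun k l => ?_⟩
  · rw [partialDeriv_gradient_eq hr k x]
    exact (norm_gradient_le_dsize₁ (hr.partialDeriv k) x).trans (dsize₁_partialDeriv_le hr x k)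
  · have e : partialDeriv k (gradient r) = gradient (partialDeriv k r) :=
      funext fun y => partialDeriv_gradient_eq hr k y
    rw [e, partialDeriv_gradient_eq (hr.partialDeriv k) l x]
    exact (norm_gradient_le_dsize₁ ((hr.partialDeriv k).partialDeriv l) x).trans
      (dsize₁_partialDeriv₂_le hr x k l)

/-- Data for `∂ᵢr`: values, first and second derivatives against the sizes. [folklore] -/
theorem partialDeriv_data (r : UnitAddTorus d → ℝ) (x : UnitAddTorus d) (i : d) :
    |partialDeriv i r x| ≤ dsize₁ r x ∧ (∀ k, |partialDeriv k (partialDeriv i r) x| ≤ dsize₂ r x) ∧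
      ∀ k l, |partialDeriv l (partialDeriv k (partialDeriv i r)) x| ≤ dsize₃ r x :=
  ⟨abs_partialDeriv_le_dsize₁ r x i, fun k => abs_partialDeriv₂_le_dsize₂ r x i k,
    fun k l => abs_partialDeriv₃_le_dsize₃ r x i k l⟩

/-- Data for `∂ᵢw`: values, first and second derivatives against the sizes. [folklore] -/
theorem partialDeriv_vdata (w : UnitAddTorus d → EuclideanSpace ℝ d) (x : UnitAddTorus d) (i : d) :
    ‖partialDeriv i w x‖ ≤ vsize₁ w x ∧ (∀ k, ‖partialDeriv k (partialDeriv i w) x‖ ≤ vsize₂ w x) ∧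
      ∀ k l, ‖partialDeriv l (partialDeriv k (partialDeriv i w)) x‖ ≤ vsize₃ w x :=
  ⟨norm_partialDeriv_le_vsize₁ w x i, fun k => norm_partialDeriv₂_le_vsize₂ w x i k,
    fun k l => norm_partialDeriv₃_le_vsize₃ w x i k l⟩

omit [DecidableEq d] in
/-- Summing a constant bound over the coordinates. [folklore] -/
theorem sum_le_card_mul {F : d → ℝ} {B : ℝ} (h : ∀ i, F i ≤ B) : ∑ i, F i ≤ Fintype.card d * B := by
  calc ∑ i, F i ≤ ∑ _i : d, B := Finset.sum_le_sum fun i _ => h i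
    _ = Fintype.card d * B := by rw [Finset.sum_const, Finset.card_univ, nsmul_eq_mul]

/-- **Bound for `T₁`**: `|T₁| ≤ |d| pv₀ S₁(r) + pc₀ V₁(w)`. [cite: Majda1984, Ch. 2 §2.1 Prop. 2.1] -/
theorem abs_tcont_le (hw : IsSmooth w) (hv₀ : ‖partialDeriv j v x‖ ≤ pv₀) (hc₀ : |partialDeriv j c x| ≤ pc₀) :
    |tcont v c r w j x| ≤ Fintype.card d * (pv₀ * dsize₁ r x) + pc₀ * vsize₁ w x := by
  have hA : |∑ i, partialDeriv j v x i * partialDeriv i r x| ≤ Fintype.card d * (pv₀ * dsize₁ r x) :=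
    (Finset.abs_sum_le_sum_abs _ _).trans (sum_le_card_mul fun i =>
      abs_mul_le₀ ((abs_apply_le_norm' _ i).trans hv₀) (abs_partialDeriv_le_dsize₁ r x i))
  have hB : |partialDeriv j c x * divergence w x| ≤ pc₀ * vsize₁ w x :=
    abs_mul_le₀ hc₀ (abs_divergence_le_vsize₁ hw x)
  exact (abs_add_le _ _).trans (add_le_add hA hB)

/-- **Bound for `∂ₖT₁`**: `|∂ₖT₁| ≤ |d| (pv₀ S₂(r) + pv₁ S₁(r)) + (pc₀ V₂(w) + pc₁ V₁(w))`.
[cite: Majda1984, Ch. 2 §2.1 Prop. 2.1] -/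
theorem abs_partialDeriv_tcont_le (hv : IsSmooth v) (hc : IsSmooth c) (hr : IsSmooth r) (hw : IsSmooth w)
    (hv₀ : ‖partialDeriv j v x‖ ≤ pv₀) (hv₁ : ∀ k, ‖partialDeriv k (partialDeriv j v) x‖ ≤ pv₁)
    (hc₀ : |partialDeriv j c x| ≤ pc₀) (hc₁ : ∀ k, |partialDeriv k (partialDeriv j c) x| ≤ pc₁) (k : d) :
    |partialDeriv k (tcont v c r w j) x| ≤
      Fintype.card d * (pv₀ * dsize₂ r x + pv₁ * dsize₁ r x) + (pc₀ * vsize₂ w x + pc₁ * vsize₁ w x) := by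
  rw [partialDeriv_tcont hv hc hr hw j k x]
  have hA : |∑ i, partialDeriv k (fun y => partialDeriv j v y i * partialDeriv i r y) x| ≤
      Fintype.card d * (pv₀ * dsize₂ r x + pv₁ * dsize₁ r x) :=
    (Finset.abs_sum_le_sum_abs _ _).trans (sum_le_card_mul fun i =>
      abs_partialDeriv_mul_le₁ (isSmooth_partialDeriv_apply hv j i) (hr.partialDeriv i)
        ((abs_apply_le_norm' _ i).trans hv₀) (abs_partialDeriv_apply_le₁ hv hv₁ i)
        (partialDeriv_data r x i).1 (partialDeriv_data r x i).2.1 k)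
  have hB : |partialDeriv k (fun y => partialDeriv j c y * divergence w y) x| ≤ pc₀ * vsize₂ w x + pc₁ * vsize₁ w x :=
    abs_partialDeriv_mul_le₁ (hc.partialDeriv j) hw.divergence hc₀ hc₁ (divergence_data (x := x) hw).1
      (divergence_data (x := x) hw).2.1 k
  exact (abs_add_le _ _).trans (add_le_add hA hB)

/-- **Bound for `∂ₗ∂ₖT₁`**:
`|∂ₗ∂ₖT₁| ≤ |d| (pv₀ S₃(r) + 2 pv₁ S₂(r) + pv₂ S₁(r)) + (pc₀ V₃(w) + 2 pc₁ V₂(w) + pc₂ V₁(w))`.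
[cite: Majda1984, Ch. 2 §2.1 Prop. 2.1] -/
theorem abs_partialDeriv₂_tcont_le (hv : IsSmooth v) (hc : IsSmooth c) (hr : IsSmooth r) (hw : IsSmooth w)
    (hv₀ : ‖partialDeriv j v x‖ ≤ pv₀) (hv₁ : ∀ k, ‖partialDeriv k (partialDeriv j v) x‖ ≤ pv₁)
    (hv₂ : ∀ k l, ‖partialDeriv l (partialDeriv k (partialDeriv j v)) x‖ ≤ pv₂)
    (hc₀ : |partialDeriv j c x| ≤ pc₀) (hc₁ : ∀ k, |partialDeriv k (partialDeriv j c) x| ≤ pc₁)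
    (hc₂ : ∀ k l, |partialDeriv l (partialDeriv k (partialDeriv j c)) x| ≤ pc₂) (k l : d) :
    |partialDeriv l (partialDeriv k (tcont v c r w j)) x| ≤
      Fintype.card d * (pv₀ * dsize₃ r x + 2 * (pv₁ * dsize₂ r x) + pv₂ * dsize₁ r x) +
        (pc₀ * vsize₃ w x + 2 * (pc₁ * vsize₂ w x) + pc₂ * vsize₁ w x) := by
  rw [partialDeriv₂_tcont hv hc hr hw j k l x]
  have hA : |∑ i, partialDeriv l (partialDeriv k (fun y => partialDeriv j v y i * partialDeriv i r y)) x| ≤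
      Fintype.card d * (pv₀ * dsize₃ r x + 2 * (pv₁ * dsize₂ r x) + pv₂ * dsize₁ r x) :=
    (Finset.abs_sum_le_sum_abs _ _).trans (sum_le_card_mul fun i =>
      abs_partialDeriv_mul_le₂ (isSmooth_partialDeriv_apply hv j i) (hr.partialDeriv i)
        ((abs_apply_le_norm' _ i).trans hv₀) (abs_partialDeriv_apply_le₁ hv hv₁ i)
        (abs_partialDeriv_apply_le₂ hv hv₂ i) (partialDeriv_data r x i).1 (partialDeriv_data r x i).2.1
        (partialDeriv_data r x i).2.2 k l)
  have hB : |partialDeriv l (partialDeriv k (fun y => partialDeriv j c y * divergence w y)) x| ≤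
      pc₀ * vsize₃ w x + 2 * (pc₁ * vsize₂ w x) + pc₂ * vsize₁ w x :=
    abs_partialDeriv_mul_le₂ (hc.partialDeriv j) hw.divergence hc₀ hc₁ hc₂ (divergence_data (x := x) hw).1
      (divergence_data (x := x) hw).2.1 (divergence_data (x := x) hw).2.2 k l
  exact (abs_add_le _ _).trans (add_le_add hA hB)

/-- **Bound for `T₂`**: `‖T₂‖ ≤ |d| pv₀ V₁(w) + pa₀ S₁(r) + pb₀ S₁(θ)`. [cite: Majda1984, Ch. 2 §2.1 Prop. 2.1] -/
theorem norm_tmom_le (hr : IsSmooth r) (hθ : IsSmooth θ) (hv₀ : ‖partialDeriv j v x‖ ≤ pv₀)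
    (ha₀ : |partialDeriv j a x| ≤ pa₀) (hb₀ : |partialDeriv j b x| ≤ pb₀) :
    ‖tmom v a b r θ w j x‖ ≤
      Fintype.card d * (pv₀ * vsize₁ w x) + pa₀ * dsize₁ r x + pb₀ * dsize₁ θ x := by
  have hA : ‖∑ i, partialDeriv j v x i • partialDeriv i w x‖ ≤ Fintype.card d * (pv₀ * vsize₁ w x) :=
    (norm_sum_le _ _).trans (sum_le_card_mul fun i =>
      norm_smul_le₀ ((abs_apply_le_norm' _ i).trans hv₀) (norm_partialDeriv_le_vsize₁ w x i))
  have hB : ‖partialDeriv j a x • gradient r x‖ ≤ pa₀ * dsize₁ r x :=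
    norm_smul_le₀ ha₀ (norm_gradient_le_dsize₁ hr x)
  have hC : ‖partialDeriv j b x • gradient θ x‖ ≤ pb₀ * dsize₁ θ x :=
    norm_smul_le₀ hb₀ (norm_gradient_le_dsize₁ hθ x)
  exact norm_add₃_le.trans (add_le_add (add_le_add hA hB) hC)

/-- **Bound for `∂ₖT₂`**. [cite: Majda1984, Ch. 2 §2.1 Prop. 2.1] -/
theorem norm_partialDeriv_tmom_le (hv : IsSmooth v) (ha : IsSmooth a) (hb : IsSmooth b) (hr : IsSmooth r)
    (hθ : IsSmooth θ) (hw : IsSmooth w)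
    (hv₀ : ‖partialDeriv j v x‖ ≤ pv₀) (hv₁ : ∀ k, ‖partialDeriv k (partialDeriv j v) x‖ ≤ pv₁)
    (ha₀ : |partialDeriv j a x| ≤ pa₀) (ha₁ : ∀ k, |partialDeriv k (partialDeriv j a) x| ≤ pa₁)
    (hb₀ : |partialDeriv j b x| ≤ pb₀) (hb₁ : ∀ k, |partialDeriv k (partialDeriv j b) x| ≤ pb₁) (k : d) :
    ‖partialDeriv k (tmom v a b r θ w j) x‖ ≤
      Fintype.card d * (pv₀ * vsize₂ w x + pv₁ * vsize₁ w x) +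
        (pa₀ * dsize₂ r x + pa₁ * dsize₁ r x) + (pb₀ * dsize₂ θ x + pb₁ * dsize₁ θ x) := by
  rw [partialDeriv_tmom hv ha hb hr hθ hw j k x]
  have hA : ‖∑ i, partialDeriv k (fun y => partialDeriv j v y i • partialDeriv i w y) x‖ ≤
      Fintype.card d * (pv₀ * vsize₂ w x + pv₁ * vsize₁ w x) :=
    (norm_sum_le _ _).trans (sum_le_card_mul fun i =>
      norm_partialDeriv_smul_le₁ (isSmooth_partialDeriv_apply hv j i) (hw.partialDeriv i)
        ((abs_apply_le_norm' _ i).trans hv₀) (abs_partialDeriv_apply_le₁ hv hv₁ i)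
        (partialDeriv_vdata w x i).1 (partialDeriv_vdata w x i).2.1 k)
  have hB : ‖partialDeriv k (fun y => partialDeriv j a y • gradient r y) x‖ ≤ pa₀ * dsize₂ r x + pa₁ * dsize₁ r x :=
    norm_partialDeriv_smul_le₁ (ha.partialDeriv j) hr.gradient ha₀ ha₁ (gradient_data (x := x) hr).1
      (gradient_data (x := x) hr).2.1 k
  have hC : ‖partialDeriv k (fun y => partialDeriv j b y • gradient θ y) x‖ ≤ pb₀ * dsize₂ θ x + pb₁ * dsize₁ θ x :=
    norm_partialDeriv_smul_le₁ (hb.partialDeriv j) hθ.gradient hb₀ hb₁ (gradient_data (x := x) hθ).1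
      (gradient_data (x := x) hθ).2.1 k
  exact norm_add₃_le.trans (add_le_add (add_le_add hA hB) hC)

/-- **Bound for `∂ₗ∂ₖT₂`**. [cite: Majda1984, Ch. 2 §2.1 Prop. 2.1] -/
theorem norm_partialDeriv₂_tmom_le (hv : IsSmooth v) (ha : IsSmooth a) (hb : IsSmooth b) (hr : IsSmooth r)
    (hθ : IsSmooth θ) (hw : IsSmooth w)
    (hv₀ : ‖partialDeriv j v x‖ ≤ pv₀) (hv₁ : ∀ k, ‖partialDeriv k (partialDeriv j v) x‖ ≤ pv₁)
    (hv₂ : ∀ k l, ‖partialDeriv l (partialDeriv k (partialDeriv j v)) x‖ ≤ pv₂)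
    (ha₀ : |partialDeriv j a x| ≤ pa₀) (ha₁ : ∀ k, |partialDeriv k (partialDeriv j a) x| ≤ pa₁)
    (ha₂ : ∀ k l, |partialDeriv l (partialDeriv k (partialDeriv j a)) x| ≤ pa₂)
    (hb₀ : |partialDeriv j b x| ≤ pb₀) (hb₁ : ∀ k, |partialDeriv k (partialDeriv j b) x| ≤ pb₁)
    (hb₂ : ∀ k l, |partialDeriv l (partialDeriv k (partialDeriv j b)) x| ≤ pb₂) (k l : d) :
    ‖partialDeriv l (partialDeriv k (tmom v a b r θ w j)) x‖ ≤
      Fintype.card d * (pv₀ * vsize₃ w x + 2 * (pv₁ * vsize₂ w x) + pv₂ * vsize₁ w x) +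
        (pa₀ * dsize₃ r x + 2 * (pa₁ * dsize₂ r x) + pa₂ * dsize₁ r x) +
        (pb₀ * dsize₃ θ x + 2 * (pb₁ * dsize₂ θ x) + pb₂ * dsize₁ θ x) := by
  rw [partialDeriv₂_tmom hv ha hb hr hθ hw j k l x]
  have hA : ‖∑ i, partialDeriv l (partialDeriv k (fun y => partialDeriv j v y i • partialDeriv i w y)) x‖ ≤
      Fintype.card d * (pv₀ * vsize₃ w x + 2 * (pv₁ * vsize₂ w x) + pv₂ * vsize₁ w x) :=
    (norm_sum_le _ _).trans (sum_le_card_mul fun i =>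
      norm_partialDeriv_smul_le₂ (isSmooth_partialDeriv_apply hv j i) (hw.partialDeriv i)
        ((abs_apply_le_norm' _ i).trans hv₀) (abs_partialDeriv_apply_le₁ hv hv₁ i)
        (abs_partialDeriv_apply_le₂ hv hv₂ i) (partialDeriv_vdata w x i).1 (partialDeriv_vdata w x i).2.1
        (partialDeriv_vdata w x i).2.2 k l)
  have hB : ‖partialDeriv l (partialDeriv k (fun y => partialDeriv j a y • gradient r y)) x‖ ≤
      pa₀ * dsize₃ r x + 2 * (pa₁ * dsize₂ r x) + pa₂ * dsize₁ r x :=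
    norm_partialDeriv_smul_le₂ (ha.partialDeriv j) hr.gradient ha₀ ha₁ ha₂ (gradient_data (x := x) hr).1
      (gradient_data (x := x) hr).2.1 (gradient_data (x := x) hr).2.2 k l
  have hC : ‖partialDeriv l (partialDeriv k (fun y => partialDeriv j b y • gradient θ y)) x‖ ≤
      pb₀ * dsize₃ θ x + 2 * (pb₁ * dsize₂ θ x) + pb₂ * dsize₁ θ x :=
    norm_partialDeriv_smul_le₂ (hb.partialDeriv j) hθ.gradient hb₀ hb₁ hb₂ (gradient_data (x := x) hθ).1
      (gradient_data (x := x) hθ).2.1 (gradient_data (x := x) hθ).2.2 k l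
  exact norm_add₃_le.trans (add_le_add (add_le_add hA hB) hC)

end TBounds

/-! ## Arithmetic: the universal constant `P = (|d| + 1)(C + 1)(M₁ + 1)` -/

section Arith

variable {P a b c e : ℝ}

omit [Fintype d] [DecidableEq d] in
/-- Products of at most four factors in `[0, P]`, `P ≥ 1`, are at most `P⁴`. [folklore] -/
theorem prod₄_le_pow (hP : 1 ≤ P) (ha : 0 ≤ a) (ha' : a ≤ P) (hb : 0 ≤ b) (hb' : b ≤ P) (hc : 0 ≤ c)
    (hc' : c ≤ P) (he : 0 ≤ e) (he' : e ≤ P) : a * b * c * e ≤ P ^ 4 := by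
  have h1 : a * b ≤ P * P := mul_le_mul ha' hb' hb (ha.trans ha')
  have h2 : a * b * c ≤ P * P * c := mul_le_mul_of_nonneg_right h1 hc
  have h3 : P * P * c ≤ P * P * P := mul_le_mul_of_nonneg_left hc' (by positivity)
  have h4 : a * b * c * e ≤ P * P * P * e := mul_le_mul_of_nonneg_right (h2.trans h3) he
  have h5 : P * P * P * e ≤ P * P * P * P := mul_le_mul_of_nonneg_left he' (by positivity)
  calc a * b * c * e ≤ P * P * P * P := h4.trans h5
    _ = P ^ 4 := by ring

omit [Fintype d] [DecidableEq d] in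
/-- Three factors. [folklore] -/
theorem prod₃_le_pow (hP : 1 ≤ P) (ha : 0 ≤ a) (ha' : a ≤ P) (hb : 0 ≤ b) (hb' : b ≤ P) (hc : 0 ≤ c)
    (hc' : c ≤ P) : a * b * c ≤ P ^ 4 := by
  have h := prod₄_le_pow hP ha ha' hb hb' hc hc' zero_le_one hP
  simpa using h

omit [Fintype d] [DecidableEq d] in
/-- Two factors. [folklore] -/
theorem prod₂_le_pow (hP : 1 ≤ P) (ha : 0 ≤ a) (ha' : a ≤ P) (hb : 0 ≤ b) (hb' : b ≤ P) : a * b ≤ P ^ 4 := by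
  have h := prod₃_le_pow hP ha ha' hb hb' zero_le_one hP
  simpa using h

omit [Fintype d] [DecidableEq d] in
/-- One factor. [folklore] -/
theorem le_pow₄ (hP : 1 ≤ P) (ha : 0 ≤ a) (ha' : a ≤ P) : a ≤ P ^ 4 := by
  have h := prod₂_le_pow hP ha ha' zero_le_one hP
  simpa using h

end Arith

/-! ## Level bounds for the differentiated Euler system -/

section Levels

variable {ρ ϑ a b g : UnitAddTorus d → ℝ} {u : UnitAddTorus d → EuclideanSpace ℝ d} {x : UnitAddTorus d}
  {M₁ C s₂ s₃ : ℝ}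

omit [DecidableEq d] in
/-- The atoms `1, 2, |d|, M₁, C` are in `[0, P]`, `P = (|d| + 1)(C + 1)(M₁ + 1) ≥ 1`. [folklore] -/
theorem atoms_le (hM0 : 0 ≤ M₁) (hC : 1 ≤ C) :
    1 ≤ ((Fintype.card d : ℝ) + 1) * (C + 1) * (M₁ + 1) ∧
    2 ≤ ((Fintype.card d : ℝ) + 1) * (C + 1) * (M₁ + 1) ∧
    (Fintype.card d : ℝ) ≤ ((Fintype.card d : ℝ) + 1) * (C + 1) * (M₁ + 1) ∧
    M₁ ≤ ((Fintype.card d : ℝ) + 1) * (C + 1) * (M₁ + 1) ∧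
    C ≤ ((Fintype.card d : ℝ) + 1) * (C + 1) * (M₁ + 1) := by
  have hn : (0 : ℝ) ≤ Fintype.card d := Nat.cast_nonneg _
  refine ⟨?_, ?_, ?_, ?_, ?_⟩ <;> nlinarith [mul_nonneg hn hM0, mul_nonneg hn (by linarith : (0:ℝ) ≤ C),
    mul_nonneg hM0 (by linarith : (0:ℝ) ≤ C), mul_nonneg (mul_nonneg hn hM0) (by linarith : (0:ℝ) ≤ C)]

/-- The size bookkeeping at a point: first derivatives against `|d| M₁`, second and third sizes of
each unknown against the totals `s₂, s₃`. [folklore] -/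
theorem sizes_le (hM : ∀ i, |partialDeriv i ρ x| ≤ M₁ ∧ ‖partialDeriv i u x‖ ≤ M₁ ∧ |partialDeriv i ϑ x| ≤ M₁)
    (hs₂ : dsize₂ ρ x + vsize₂ u x + dsize₂ ϑ x ≤ s₂) (hs₃ : dsize₃ ρ x + vsize₃ u x + dsize₃ ϑ x ≤ s₃) :
    dsize₁ ρ x ≤ Fintype.card d * M₁ ∧ vsize₁ u x ≤ Fintype.card d * M₁ ∧ dsize₁ ϑ x ≤ Fintype.card d * M₁ ∧
    dsize₂ ρ x ≤ s₂ ∧ vsize₂ u x ≤ s₂ ∧ dsize₂ ϑ x ≤ s₂ ∧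
    dsize₃ ρ x ≤ s₃ ∧ vsize₃ u x ≤ s₃ ∧ dsize₃ ϑ x ≤ s₃ ∧ 0 ≤ s₂ ∧ 0 ≤ s₃ := by
  have n1 := dsize₂_nonneg ρ x; have n2 := vsize₂_nonneg u x; have n3 := dsize₂_nonneg ϑ x
  have m1 := dsize₃_nonneg ρ x; have m2 := vsize₃_nonneg u x; have m3 := dsize₃_nonneg ϑ x
  refine ⟨sum_le_card_mul fun i => (hM i).1, sum_le_card_mul fun i => (hM i).2.1,
    sum_le_card_mul fun i => (hM i).2.2, by linarith, by linarith, by linarith, by linarith, by linarith,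
    by linarith, by linarith, by linarith⟩

/-- The universal level constant `12 P⁴`, `P = (|d| + 1)(C + 1)(M₁ + 1)`. [folklore] -/
def levelConst (d : Type*) [Fintype d] (C M₁ : ℝ) : ℝ := 12 * (((Fintype.card d : ℝ) + 1) * (C + 1) * (M₁ + 1)) ^ 4

omit [DecidableEq d] in
/-- The level constant is nonnegative. [folklore] -/
theorem levelConst_nonneg (C M₁ : ℝ) : 0 ≤ levelConst d C M₁ := by
  unfold levelConst; positivity

omit [DecidableEq d] in
/-- Common preliminaries of the level bounds: the atom bounds and the powers `P⁴` dominating the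
products of atoms that occur as coefficients. [folklore] -/
theorem level_prelim (hM0 : 0 ≤ M₁) (hC : 1 ≤ C) :
    let P := ((Fintype.card d : ℝ) + 1) * (C + 1) * (M₁ + 1)
    0 ≤ P ^ 4 ∧ (1 : ℝ) ≤ P ^ 4 ∧ (2 : ℝ) ≤ P ^ 4 ∧ (Fintype.card d : ℝ) ≤ P ^ 4 ∧ M₁ ≤ P ^ 4 ∧ C ≤ P ^ 4 ∧
      (Fintype.card d : ℝ) * M₁ ≤ P ^ 4 ∧ (Fintype.card d : ℝ) * (Fintype.card d : ℝ) * M₁ ≤ P ^ 4 ∧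
      2 * (Fintype.card d : ℝ) ≤ P ^ 4 ∧ 2 * C ≤ P ^ 4 ∧ 2 * 2 * C ≤ P ^ 4 ∧
      C * (Fintype.card d : ℝ) * M₁ ≤ P ^ 4 ∧ 2 * C * (Fintype.card d : ℝ) * M₁ ≤ P ^ 4 ∧
      (Fintype.card d : ℝ) * M₁ * (Fintype.card d : ℝ) * M₁ ≤ P ^ 4 ∧ M₁ * (Fintype.card d : ℝ) * M₁ ≤ P ^ 4 ∧
      C * (Fintype.card d : ℝ) ≤ P ^ 4 := by
  intro P
  obtain ⟨hP1, hP2, hPd, hPM, hPC⟩ := atoms_le (d := d) hM0 hC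
  have hn : (0 : ℝ) ≤ Fintype.card d := Nat.cast_nonneg _
  have h2 : (0 : ℝ) ≤ 2 := by norm_num
  have hC0 : 0 ≤ C := by linarith
  refine ⟨by positivity, one_le_pow₀ hP1, le_pow₄ hP1 h2 hP2, le_pow₄ hP1 hn hPd, le_pow₄ hP1 hM0 hPM,
    le_pow₄ hP1 hC0 hPC, prod₂_le_pow hP1 hn hPd hM0 hPM, prod₃_le_pow hP1 hn hPd hn hPd hM0 hPM,
    prod₂_le_pow hP1 h2 hP2 hn hPd, prod₂_le_pow hP1 h2 hP2 hC0 hPC, prod₃_le_pow hP1 h2 hP2 h2 hP2 hC0 hPC,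
    prod₃_le_pow hP1 hC0 hPC hn hPd hM0 hPM, prod₄_le_pow hP1 h2 hP2 hC0 hPC hn hPd hM0 hPM,
    prod₄_le_pow hP1 hn hPd hM0 hPM hn hPd hM0 hPM, prod₃_le_pow hP1 hM0 hPM hn hPd hM0 hPM,
    prod₂_le_pow hP1 hC0 hPC hn hPd⟩

variable (hρ : IsSmooth ρ) (hu : IsSmooth u) (hϑ : IsSmooth ϑ) (ha : IsSmooth a) (hb : IsSmooth b)
  (hg : IsSmooth g) (hM0 : 0 ≤ M₁) (hC : 1 ≤ C)
  (hM : ∀ i, |partialDeriv i ρ x| ≤ M₁ ∧ ‖partialDeriv i u x‖ ≤ M₁ ∧ |partialDeriv i ϑ x| ≤ M₁)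
  (hs₂ : dsize₂ ρ x + vsize₂ u x + dsize₂ ϑ x ≤ s₂) (hs₃ : dsize₃ ρ x + vsize₃ u x + dsize₃ ϑ x ≤ s₃)
  (Ha : HasDerivBoundsAt₃ a x C s₂ s₃) (Hb : HasDerivBoundsAt₃ b x C s₂ s₃) (Hg : HasDerivBoundsAt₃ g x C s₂ s₃)

include hM hs₂ hs₃ in
/-- Second derivatives of `u`, `ρ`, `ϑ` against `s₂`, third against `s₃`. [folklore] -/
theorem second_third_le :
    (∀ j k, ‖partialDeriv k (partialDeriv j u) x‖ ≤ s₂) ∧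
    (∀ j k l, ‖partialDeriv l (partialDeriv k (partialDeriv j u)) x‖ ≤ s₃) ∧
    (∀ j k, |partialDeriv k (partialDeriv j ρ) x| ≤ s₂) ∧
    (∀ j k l, |partialDeriv l (partialDeriv k (partialDeriv j ρ)) x| ≤ s₃) ∧
    (∀ j k, |partialDeriv k (partialDeriv j ϑ) x| ≤ s₂) ∧
    (∀ j k l, |partialDeriv l (partialDeriv k (partialDeriv j ϑ)) x| ≤ s₃) := by
  obtain ⟨-, -, -, d2ρ, d2u, d2ϑ, d3ρ, d3u, d3ϑ, -, -⟩ := sizes_le hM hs₂ hs₃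
  exact ⟨fun j k => (norm_partialDeriv₂_le_vsize₂ u x j k).trans d2u,
    fun j k l => (norm_partialDeriv₃_le_vsize₃ u x j k l).trans d3u,
    fun j k => (abs_partialDeriv₂_le_dsize₂ ρ x j k).trans d2ρ,
    fun j k l => (abs_partialDeriv₃_le_dsize₃ ρ x j k l).trans d3ρ,
    fun j k => (abs_partialDeriv₂_le_dsize₂ ϑ x j k).trans d2ϑ,
    fun j k l => (abs_partialDeriv₃_le_dsize₃ ϑ x j k l).trans d3ϑ⟩

include hu hM0 hC hM hs₂ hs₃ in
/-- **Continuity equation, level 1**: `|T₁(ρ, u)ⱼ| ≤ K`. [cite: Majda1984, Ch. 2 §2.1, proof of Thm 2.1] -/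
theorem cont_level₁ (j : d) : |tcont u ρ ρ u j x| ≤ levelConst d C M₁ := by
  obtain ⟨d1ρ, d1u, -, -, -, -, -, -, -, -, -⟩ := sizes_le hM hs₂ hs₃
  obtain ⟨hP0, -, -, -, -, -, -, -, -, -, -, -, -, q1, q2, -⟩ := level_prelim (d := d) hM0 hC
  have h0 := abs_tcont_le (r := ρ) (x := x) (j := j) hu (hM j).2.1 (hM j).1
  have h1 : Fintype.card d * (M₁ * dsize₁ ρ x) + M₁ * vsize₁ u x ≤
      Fintype.card d * (M₁ * (Fintype.card d * M₁)) + M₁ * (Fintype.card d * M₁) := by gcongr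
  have e : Fintype.card d * (M₁ * (Fintype.card d * M₁)) + M₁ * (Fintype.card d * M₁) =
      Fintype.card d * M₁ * Fintype.card d * M₁ + M₁ * Fintype.card d * M₁ := by ring
  unfold levelConst
  linarith

include hρ hu hM0 hC hM hs₂ hs₃ in
/-- **Continuity equation, level 2**: `|∂ₖT₁(ρ, u)ⱼ| ≤ K(1 + s₂)` and `|T₁(∂ⱼρ, ∂ⱼu)ₖ| ≤ K(1 + s₂)`.
[cite: Majda1984, Ch. 2 §2.1, proof of Thm 2.1] -/
theorem cont_level₂ (j k : d) :
    |partialDeriv k (tcont u ρ ρ u j) x| ≤ levelConst d C M₁ * (1 + s₂) ∧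
    |tcont u ρ (partialDeriv j ρ) (partialDeriv j u) k x| ≤ levelConst d C M₁ * (1 + s₂) := by
  obtain ⟨d1ρ, d1u, -, d2ρ, d2u, -, -, -, -, hs₂0, -⟩ := sizes_le hM hs₂ hs₃
  obtain ⟨u2, -, ρ2, -, -, -⟩ := second_third_le hM hs₂ hs₃
  obtain ⟨hP0, hP1, -, -, qM, -, qnM, qnnM, -, -, -, -, -, -, -, -⟩ := level_prelim (d := d) hM0 hC
  set P4 := (((Fintype.card d : ℝ) + 1) * (C + 1) * (M₁ + 1)) ^ 4 with hP4
  have hK : levelConst d C M₁ = 12 * P4 := rfl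
  have hPs₂ : 0 ≤ P4 * s₂ := mul_nonneg hP0 hs₂0
  constructor
  · have h0 := abs_partialDeriv_tcont_le (r := ρ) (w := u) (x := x) (j := j) hu hρ hρ hu (hM j).2.1 (u2 j)
      (hM j).1 (ρ2 j) k
    have h1 : Fintype.card d * (M₁ * dsize₂ ρ x + s₂ * dsize₁ ρ x) + (M₁ * vsize₂ u x + s₂ * vsize₁ u x) ≤
        Fintype.card d * (M₁ * s₂ + s₂ * (Fintype.card d * M₁)) + (M₁ * s₂ + s₂ * (Fintype.card d * M₁)) := by
      gcongr
    have t1 := mul_le_mul_of_nonneg_right qnM hs₂0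
    have t2 := mul_le_mul_of_nonneg_right qnnM hs₂0
    have t3 := mul_le_mul_of_nonneg_right qM hs₂0
    rw [hK]; linarith
  · have hr1 : dsize₁ (partialDeriv j ρ) x ≤ s₂ := (dsize₁_partialDeriv_le hρ x j).trans d2ρ
    have hw1 : vsize₁ (partialDeriv j u) x ≤ s₂ := (vsize₁_partialDeriv_le hu x j).trans d2u
    have h0 := abs_tcont_le (v := u) (c := ρ) (r := partialDeriv j ρ) (x := x) (j := k) (hu.partialDeriv j)
      (hM k).2.1 (hM k).1
    have h1 : Fintype.card d * (M₁ * dsize₁ (partialDeriv j ρ) x) + M₁ * vsize₁ (partialDeriv j u) x ≤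
        Fintype.card d * (M₁ * s₂) + M₁ * s₂ := by gcongr
    have t1 := mul_le_mul_of_nonneg_right qnM hs₂0
    have t3 := mul_le_mul_of_nonneg_right qM hs₂0
    rw [hK]; linarith

include hρ hu hM0 hC hM hs₂ hs₃ in
/-- **Continuity equation, level 3**: the three pieces `∂ₗ∂ₖT₁(ρ,u)ⱼ`, `∂ₗT₁(∂ⱼρ,∂ⱼu)ₖ`,
`T₁(∂ₖ∂ⱼρ,∂ₖ∂ⱼu)ₗ` are bounded by `K(1 + s₂ + s₃ + s₂²)`. [cite: Majda1984, Ch. 2 §2.1, proof of Thm 2.1] -/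
theorem cont_level₃ (j k l : d) :
    |partialDeriv l (partialDeriv k (tcont u ρ ρ u j)) x| ≤ levelConst d C M₁ * (1 + s₂ + s₃ + s₂ * s₂) ∧
    |partialDeriv l (tcont u ρ (partialDeriv j ρ) (partialDeriv j u) k) x| ≤
      levelConst d C M₁ * (1 + s₂ + s₃ + s₂ * s₂) ∧
    |tcont u ρ (partialDeriv k (partialDeriv j ρ)) (partialDeriv k (partialDeriv j u)) l x| ≤
      levelConst d C M₁ * (1 + s₂ + s₃ + s₂ * s₂) := by
  obtain ⟨d1ρ, d1u, -, d2ρ, d2u, -, d3ρ, d3u, -, hs₂0, hs₃0⟩ := sizes_le hM hs₂ hs₃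
  obtain ⟨u2, u3, ρ2, ρ3, -, -⟩ := second_third_le hM hs₂ hs₃
  obtain ⟨hP0, hP1, h2, hn, qM, -, qnM, qnnM, q2n, -, -, -, -, -, -, -⟩ := level_prelim (d := d) hM0 hC
  set P4 := (((Fintype.card d : ℝ) + 1) * (C + 1) * (M₁ + 1)) ^ 4 with hP4
  have hK : levelConst d C M₁ = 12 * P4 := rfl
  have hss : 0 ≤ s₂ * s₂ := mul_nonneg hs₂0 hs₂0
  have hPs₂ : 0 ≤ P4 * s₂ := mul_nonneg hP0 hs₂0
  have hPs₃ : 0 ≤ P4 * s₃ := mul_nonneg hP0 hs₃0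
  have hPss : 0 ≤ P4 * (s₂ * s₂) := mul_nonneg hP0 hss
  refine ⟨?_, ?_, ?_⟩
  · have h0 := abs_partialDeriv₂_tcont_le (r := ρ) (w := u) (x := x) (j := j) hu hρ hρ hu (hM j).2.1 (u2 j) (u3 j)
      (hM j).1 (ρ2 j) (ρ3 j) k l
    have h1 : Fintype.card d * (M₁ * dsize₃ ρ x + 2 * (s₂ * dsize₂ ρ x) + s₃ * dsize₁ ρ x) +
        (M₁ * vsize₃ u x + 2 * (s₂ * vsize₂ u x) + s₃ * vsize₁ u x) ≤
        Fintype.card d * (M₁ * s₃ + 2 * (s₂ * s₂) + s₃ * (Fintype.card d * M₁)) +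
        (M₁ * s₃ + 2 * (s₂ * s₂) + s₃ * (Fintype.card d * M₁)) := by gcongr
    have t1 := mul_le_mul_of_nonneg_right qnM hs₃0
    have t2 := mul_le_mul_of_nonneg_right qnnM hs₃0
    have t3 := mul_le_mul_of_nonneg_right qM hs₃0
    have t4 := mul_le_mul_of_nonneg_right q2n hss
    have t5 := mul_le_mul_of_nonneg_right h2 hss
    rw [hK]; linarith
  · have hr1 : dsize₁ (partialDeriv j ρ) x ≤ s₂ := (dsize₁_partialDeriv_le hρ x j).trans d2ρ
    have hr2 : dsize₂ (partialDeriv j ρ) x ≤ s₃ := (dsize₂_partialDeriv_le hρ x j).trans d3ρ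
    have hw1 : vsize₁ (partialDeriv j u) x ≤ s₂ := (vsize₁_partialDeriv_le hu x j).trans d2u
    have hw2 : vsize₂ (partialDeriv j u) x ≤ s₃ := (vsize₂_partialDeriv_le hu x j).trans d3u
    have h0 := abs_partialDeriv_tcont_le (v := u) (c := ρ) (r := partialDeriv j ρ) (w := partialDeriv j u)
      (x := x) (j := k) hu hρ (hρ.partialDeriv j) (hu.partialDeriv j) (hM k).2.1 (u2 k) (hM k).1 (ρ2 k) l
    have h1 : Fintype.card d * (M₁ * dsize₂ (partialDeriv j ρ) x + s₂ * dsize₁ (partialDeriv j ρ) x) +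
        (M₁ * vsize₂ (partialDeriv j u) x + s₂ * vsize₁ (partialDeriv j u) x) ≤
        Fintype.card d * (M₁ * s₃ + s₂ * s₂) + (M₁ * s₃ + s₂ * s₂) := by gcongr
    have t1 := mul_le_mul_of_nonneg_right qnM hs₃0
    have t3 := mul_le_mul_of_nonneg_right qM hs₃0
    have t4 := mul_le_mul_of_nonneg_right hn hss
    have t5 := mul_le_mul_of_nonneg_right hP1 hss
    rw [hK]; linarith
  · have hr1 : dsize₁ (partialDeriv k (partialDeriv j ρ)) x ≤ s₃ := (dsize₁_partialDeriv₂_le hρ x j k).trans d3ρ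
    have hw1 : vsize₁ (partialDeriv k (partialDeriv j u)) x ≤ s₃ := (vsize₁_partialDeriv₂_le hu x j k).trans d3u
    have h0 := abs_tcont_le (v := u) (c := ρ) (r := partialDeriv k (partialDeriv j ρ)) (x := x) (j := l)
      ((hu.partialDeriv j).partialDeriv k) (hM l).2.1 (hM l).1
    have h1 : Fintype.card d * (M₁ * dsize₁ (partialDeriv k (partialDeriv j ρ)) x) +
        M₁ * vsize₁ (partialDeriv k (partialDeriv j u)) x ≤ Fintype.card d * (M₁ * s₃) + M₁ * s₃ := by gcongr
    have t1 := mul_le_mul_of_nonneg_right qnM hs₃0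
    have t3 := mul_le_mul_of_nonneg_right qM hs₃0
    rw [hK]; linarith

include hρ hϑ hM0 hC hM hs₂ hs₃ Ha Hb in
/-- **Momentum equation, level 1**: `‖T₂(ρ, ϑ, u)ⱼ‖ ≤ K`. [cite: Majda1984, Ch. 2 §2.1, proof of Thm 2.1] -/
theorem mom_level₁ (j : d) : ‖tmom u a b ρ ϑ u j x‖ ≤ levelConst d C M₁ := by
  obtain ⟨d1ρ, d1u, d1ϑ, -, -, -, -, -, -, -, -⟩ := sizes_le hM hs₂ hs₃
  obtain ⟨hP0, -, -, -, -, -, -, -, -, -, -, qCnM, -, qnMnM, -, -⟩ := level_prelim (d := d) hM0 hC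
  set P4 := (((Fintype.card d : ℝ) + 1) * (C + 1) * (M₁ + 1)) ^ 4 with hP4
  have hK : levelConst d C M₁ = 12 * P4 := rfl
  have hC0 : 0 ≤ C := by linarith
  have h0 := norm_tmom_le (v := u) (a := a) (b := b) (r := ρ) (θ := ϑ) (w := u) (x := x) (j := j) hρ hϑ
    (hM j).2.1 (Ha.one j) (Hb.one j)
  have h1 : Fintype.card d * (M₁ * vsize₁ u x) + C * dsize₁ ρ x + C * dsize₁ ϑ x ≤
      Fintype.card d * (M₁ * (Fintype.card d * M₁)) + C * (Fintype.card d * M₁) + C * (Fintype.card d * M₁) := by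
    gcongr
  rw [hK]; linarith

include hρ hu hϑ ha hb hM0 hC hM hs₂ hs₃ Ha Hb in
/-- **Momentum equation, level 2**: `‖∂ₖT₂(ρ,ϑ,u)ⱼ‖`, `‖T₂(∂ⱼρ,∂ⱼϑ,∂ⱼu)ₖ‖ ≤ K(1 + s₂)`.
[cite: Majda1984, Ch. 2 §2.1, proof of Thm 2.1] -/
theorem mom_level₂ (j k : d) :
    ‖partialDeriv k (tmom u a b ρ ϑ u j) x‖ ≤ levelConst d C M₁ * (1 + s₂) ∧
    ‖tmom u a b (partialDeriv j ρ) (partialDeriv j ϑ) (partialDeriv j u) k x‖ ≤ levelConst d C M₁ * (1 + s₂) := by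
  obtain ⟨d1ρ, d1u, d1ϑ, d2ρ, d2u, d2ϑ, -, -, -, hs₂0, -⟩ := sizes_le hM hs₂ hs₃
  obtain ⟨u2, -, -, -, -, -⟩ := second_third_le hM hs₂ hs₃
  obtain ⟨hP0, hP1, -, -, qM, qC, qnM, qnnM, -, -, -, qCnM, -, -, -, -⟩ := level_prelim (d := d) hM0 hC
  set P4 := (((Fintype.card d : ℝ) + 1) * (C + 1) * (M₁ + 1)) ^ 4 with hP4
  have hK : levelConst d C M₁ = 12 * P4 := rfl
  have hC0 : 0 ≤ C := by linarith
  have hA1 : 0 ≤ C * (1 + s₂) := by positivity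
  have hPs₂ : 0 ≤ P4 * s₂ := mul_nonneg hP0 hs₂0
  constructor
  · have h0 := norm_partialDeriv_tmom_le (v := u) (a := a) (b := b) (r := ρ) (θ := ϑ) (w := u) (x := x) (j := j)
      hu ha hb hρ hϑ hu (hM j).2.1 (u2 j) (Ha.one j) (fun k' => Ha.two j k') (Hb.one j) (fun k' => Hb.two j k') k
    have h1 : Fintype.card d * (M₁ * vsize₂ u x + s₂ * vsize₁ u x) +
        (C * dsize₂ ρ x + C * (1 + s₂) * dsize₁ ρ x) + (C * dsize₂ ϑ x + C * (1 + s₂) * dsize₁ ϑ x) ≤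
        Fintype.card d * (M₁ * s₂ + s₂ * (Fintype.card d * M₁)) +
        (C * s₂ + C * (1 + s₂) * (Fintype.card d * M₁)) + (C * s₂ + C * (1 + s₂) * (Fintype.card d * M₁)) := by
      gcongr
    have t1 := mul_le_mul_of_nonneg_right qnM hs₂0
    have t2 := mul_le_mul_of_nonneg_right qnnM hs₂0
    have t3 := mul_le_mul_of_nonneg_right qC hs₂0
    have t4 := mul_le_mul_of_nonneg_right qCnM hs₂0
    rw [hK]; linarith
  · have hr1 : dsize₁ (partialDeriv j ρ) x ≤ s₂ := (dsize₁_partialDeriv_le hρ x j).trans d2ρ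
    have hθ1 : dsize₁ (partialDeriv j ϑ) x ≤ s₂ := (dsize₁_partialDeriv_le hϑ x j).trans d2ϑ
    have hw1 : vsize₁ (partialDeriv j u) x ≤ s₂ := (vsize₁_partialDeriv_le hu x j).trans d2u
    have h0 := norm_tmom_le (v := u) (a := a) (b := b) (r := partialDeriv j ρ) (θ := partialDeriv j ϑ)
      (w := partialDeriv j u) (x := x) (j := k) (hρ.partialDeriv j) (hϑ.partialDeriv j) (hM k).2.1 (Ha.one k) (Hb.one k)
    have h1 : Fintype.card d * (M₁ * vsize₁ (partialDeriv j u) x) + C * dsize₁ (partialDeriv j ρ) x +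
        C * dsize₁ (partialDeriv j ϑ) x ≤ Fintype.card d * (M₁ * s₂) + C * s₂ + C * s₂ := by gcongr
    have t1 := mul_le_mul_of_nonneg_right qnM hs₂0
    have t3 := mul_le_mul_of_nonneg_right qC hs₂0
    rw [hK]; linarith

include hρ hu hϑ ha hb hM0 hC hM hs₂ hs₃ Ha Hb in
/-- **Momentum equation, level 3**: the three pieces are bounded by `K(1 + s₂ + s₃ + s₂²)`.
[cite: Majda1984, Ch. 2 §2.1, proof of Thm 2.1] -/
theorem mom_level₃ (j k l : d) :
    ‖partialDeriv l (partialDeriv k (tmom u a b ρ ϑ u j)) x‖ ≤ levelConst d C M₁ * (1 + s₂ + s₃ + s₂ * s₂) ∧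
    ‖partialDeriv l (tmom u a b (partialDeriv j ρ) (partialDeriv j ϑ) (partialDeriv j u) k) x‖ ≤
      levelConst d C M₁ * (1 + s₂ + s₃ + s₂ * s₂) ∧
    ‖tmom u a b (partialDeriv k (partialDeriv j ρ)) (partialDeriv k (partialDeriv j ϑ))
        (partialDeriv k (partialDeriv j u)) l x‖ ≤ levelConst d C M₁ * (1 + s₂ + s₃ + s₂ * s₂) := by
  obtain ⟨d1ρ, d1u, d1ϑ, d2ρ, d2u, d2ϑ, d3ρ, d3u, d3ϑ, hs₂0, hs₃0⟩ := sizes_le hM hs₂ hs₃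
  obtain ⟨u2, u3, -, -, -, -⟩ := second_third_le hM hs₂ hs₃
  obtain ⟨hP0, hP1, h2, hn, qM, qC, qnM, qnnM, q2n, q2C, -, qCnM, -, -, -, -⟩ := level_prelim (d := d) hM0 hC
  set P4 := (((Fintype.card d : ℝ) + 1) * (C + 1) * (M₁ + 1)) ^ 4 with hP4
  have hK : levelConst d C M₁ = 12 * P4 := rfl
  have hC0 : 0 ≤ C := by linarith
  have hA1 : 0 ≤ C * (1 + s₂) := by positivity
  have hA2 : 0 ≤ C * (1 + s₂ + s₃) := by positivity
  have hss : 0 ≤ s₂ * s₂ := mul_nonneg hs₂0 hs₂0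
  have hPs₂ : 0 ≤ P4 * s₂ := mul_nonneg hP0 hs₂0
  have hPs₃ : 0 ≤ P4 * s₃ := mul_nonneg hP0 hs₃0
  have hPss : 0 ≤ P4 * (s₂ * s₂) := mul_nonneg hP0 hss
  refine ⟨?_, ?_, ?_⟩
  · have h0 := norm_partialDeriv₂_tmom_le (v := u) (a := a) (b := b) (r := ρ) (θ := ϑ) (w := u) (x := x) (j := j)
      hu ha hb hρ hϑ hu (hM j).2.1 (u2 j) (u3 j) (Ha.one j) (fun k' => Ha.two j k') (fun k' l' => Ha.three j k' l')
      (Hb.one j) (fun k' => Hb.two j k') (fun k' l' => Hb.three j k' l') k l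
    have h1 : Fintype.card d * (M₁ * vsize₃ u x + 2 * (s₂ * vsize₂ u x) + s₃ * vsize₁ u x) +
        (C * dsize₃ ρ x + 2 * (C * (1 + s₂) * dsize₂ ρ x) + C * (1 + s₂ + s₃) * dsize₁ ρ x) +
        (C * dsize₃ ϑ x + 2 * (C * (1 + s₂) * dsize₂ ϑ x) + C * (1 + s₂ + s₃) * dsize₁ ϑ x) ≤
        Fintype.card d * (M₁ * s₃ + 2 * (s₂ * s₂) + s₃ * (Fintype.card d * M₁)) +
        (C * s₃ + 2 * (C * (1 + s₂) * s₂) + C * (1 + s₂ + s₃) * (Fintype.card d * M₁)) +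
        (C * s₃ + 2 * (C * (1 + s₂) * s₂) + C * (1 + s₂ + s₃) * (Fintype.card d * M₁)) := by
      gcongr
    have t1 := mul_le_mul_of_nonneg_right qnM hs₃0
    have t2 := mul_le_mul_of_nonneg_right q2n hss
    have t3 := mul_le_mul_of_nonneg_right qnnM hs₃0
    have t4 := mul_le_mul_of_nonneg_right qC hs₃0
    have t5 := mul_le_mul_of_nonneg_right q2C hs₂0
    have t6 := mul_le_mul_of_nonneg_right q2C hss
    have t7 := mul_le_mul_of_nonneg_right qCnM hs₂0
    have t8 := mul_le_mul_of_nonneg_right qCnM hs₃0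
    rw [hK]; linarith
  · have hr1 : dsize₁ (partialDeriv j ρ) x ≤ s₂ := (dsize₁_partialDeriv_le hρ x j).trans d2ρ
    have hr2 : dsize₂ (partialDeriv j ρ) x ≤ s₃ := (dsize₂_partialDeriv_le hρ x j).trans d3ρ
    have hθ1 : dsize₁ (partialDeriv j ϑ) x ≤ s₂ := (dsize₁_partialDeriv_le hϑ x j).trans d2ϑ
    have hθ2 : dsize₂ (partialDeriv j ϑ) x ≤ s₃ := (dsize₂_partialDeriv_le hϑ x j).trans d3ϑ
    have hw1 : vsize₁ (partialDeriv j u) x ≤ s₂ := (vsize₁_partialDeriv_le hu x j).trans d2u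
    have hw2 : vsize₂ (partialDeriv j u) x ≤ s₃ := (vsize₂_partialDeriv_le hu x j).trans d3u
    have h0 := norm_partialDeriv_tmom_le (v := u) (a := a) (b := b) (r := partialDeriv j ρ) (θ := partialDeriv j ϑ)
      (w := partialDeriv j u) (x := x) (j := k) hu ha hb (hρ.partialDeriv j) (hϑ.partialDeriv j) (hu.partialDeriv j)
      (hM k).2.1 (u2 k) (Ha.one k) (fun k' => Ha.two k k') (Hb.one k) (fun k' => Hb.two k k') l
    have h1 : Fintype.card d * (M₁ * vsize₂ (partialDeriv j u) x + s₂ * vsize₁ (partialDeriv j u) x) +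
        (C * dsize₂ (partialDeriv j ρ) x + C * (1 + s₂) * dsize₁ (partialDeriv j ρ) x) +
        (C * dsize₂ (partialDeriv j ϑ) x + C * (1 + s₂) * dsize₁ (partialDeriv j ϑ) x) ≤
        Fintype.card d * (M₁ * s₃ + s₂ * s₂) + (C * s₃ + C * (1 + s₂) * s₂) + (C * s₃ + C * (1 + s₂) * s₂) := by
      gcongr
    have t1 := mul_le_mul_of_nonneg_right qnM hs₃0
    have t2 := mul_le_mul_of_nonneg_right hn hss
    have t3 := mul_le_mul_of_nonneg_right qC hs₃0
    have t4 := mul_le_mul_of_nonneg_right qC hs₂0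
    have t5 := mul_le_mul_of_nonneg_right qC hss
    rw [hK]; linarith
  · have hr1 : dsize₁ (partialDeriv k (partialDeriv j ρ)) x ≤ s₃ := (dsize₁_partialDeriv₂_le hρ x j k).trans d3ρ
    have hθ1 : dsize₁ (partialDeriv k (partialDeriv j ϑ)) x ≤ s₃ := (dsize₁_partialDeriv₂_le hϑ x j k).trans d3ϑ
    have hw1 : vsize₁ (partialDeriv k (partialDeriv j u)) x ≤ s₃ := (vsize₁_partialDeriv₂_le hu x j k).trans d3u
    have h0 := norm_tmom_le (v := u) (a := a) (b := b) (r := partialDeriv k (partialDeriv j ρ))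
      (θ := partialDeriv k (partialDeriv j ϑ)) (w := partialDeriv k (partialDeriv j u)) (x := x) (j := l)
      ((hρ.partialDeriv j).partialDeriv k) ((hϑ.partialDeriv j).partialDeriv k) (hM l).2.1 (Ha.one l) (Hb.one l)
    have h1 : Fintype.card d * (M₁ * vsize₁ (partialDeriv k (partialDeriv j u)) x) +
        C * dsize₁ (partialDeriv k (partialDeriv j ρ)) x + C * dsize₁ (partialDeriv k (partialDeriv j ϑ)) x ≤
        Fintype.card d * (M₁ * s₃) + C * s₃ + C * s₃ := by gcongr
    have t1 := mul_le_mul_of_nonneg_right qnM hs₃0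
    have t3 := mul_le_mul_of_nonneg_right qC hs₃0
    rw [hK]; linarith

include hu hM0 hC hM hs₂ hs₃ Hg in
/-- **Temperature equation, level 1**: `|T₁(ϑ, u)ⱼ| ≤ K` (coefficient `g`). [cite: Majda1984, Ch. 2 §2.1, proof of Thm 2.1] -/
theorem temp_level₁ (j : d) : |tcont u g ϑ u j x| ≤ levelConst d C M₁ := by
  obtain ⟨-, d1u, d1ϑ, -, -, -, -, -, -, -, -⟩ := sizes_le hM hs₂ hs₃
  obtain ⟨hP0, -, -, -, -, -, -, -, -, -, -, qCnM, -, qnMnM, -, -⟩ := level_prelim (d := d) hM0 hC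
  set P4 := (((Fintype.card d : ℝ) + 1) * (C + 1) * (M₁ + 1)) ^ 4 with hP4
  have hK : levelConst d C M₁ = 12 * P4 := rfl
  have hC0 : 0 ≤ C := by linarith
  have h0 := abs_tcont_le (v := u) (c := g) (r := ϑ) (w := u) (x := x) (j := j) hu (hM j).2.1 (Hg.one j)
  have h1 : Fintype.card d * (M₁ * dsize₁ ϑ x) + C * vsize₁ u x ≤
      Fintype.card d * (M₁ * (Fintype.card d * M₁)) + C * (Fintype.card d * M₁) := by gcongr
  rw [hK]; linarith

include hu hϑ hg hM0 hC hM hs₂ hs₃ Hg in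
/-- **Temperature equation, level 2**. [cite: Majda1984, Ch. 2 §2.1, proof of Thm 2.1] -/
theorem temp_level₂ (j k : d) :
    |partialDeriv k (tcont u g ϑ u j) x| ≤ levelConst d C M₁ * (1 + s₂) ∧
    |tcont u g (partialDeriv j ϑ) (partialDeriv j u) k x| ≤ levelConst d C M₁ * (1 + s₂) := by
  obtain ⟨-, d1u, d1ϑ, -, d2u, d2ϑ, -, -, -, hs₂0, -⟩ := sizes_le hM hs₂ hs₃
  obtain ⟨u2, -, -, -, -, -⟩ := second_third_le hM hs₂ hs₃
  obtain ⟨hP0, hP1, -, -, qM, qC, qnM, qnnM, -, -, -, qCnM, -, -, -, -⟩ := level_prelim (d := d) hM0 hC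
  set P4 := (((Fintype.card d : ℝ) + 1) * (C + 1) * (M₁ + 1)) ^ 4 with hP4
  have hK : levelConst d C M₁ = 12 * P4 := rfl
  have hC0 : 0 ≤ C := by linarith
  have hA1 : 0 ≤ C * (1 + s₂) := by positivity
  have hPs₂ : 0 ≤ P4 * s₂ := mul_nonneg hP0 hs₂0
  constructor
  · have h0 := abs_partialDeriv_tcont_le (v := u) (c := g) (r := ϑ) (w := u) (x := x) (j := j) hu hg hϑ hu
      (hM j).2.1 (u2 j) (Hg.one j) (fun k' => Hg.two j k') k
    have h1 : Fintype.card d * (M₁ * dsize₂ ϑ x + s₂ * dsize₁ ϑ x) + (C * vsize₂ u x + C * (1 + s₂) * vsize₁ u x) ≤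
        Fintype.card d * (M₁ * s₂ + s₂ * (Fintype.card d * M₁)) + (C * s₂ + C * (1 + s₂) * (Fintype.card d * M₁)) := by
      gcongr
    have t1 := mul_le_mul_of_nonneg_right qnM hs₂0
    have t2 := mul_le_mul_of_nonneg_right qnnM hs₂0
    have t3 := mul_le_mul_of_nonneg_right qC hs₂0
    have t4 := mul_le_mul_of_nonneg_right qCnM hs₂0
    rw [hK]; linarith
  · have hθ1 : dsize₁ (partialDeriv j ϑ) x ≤ s₂ := (dsize₁_partialDeriv_le hϑ x j).trans d2ϑ
    have hw1 : vsize₁ (partialDeriv j u) x ≤ s₂ := (vsize₁_partialDeriv_le hu x j).trans d2u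
    have h0 := abs_tcont_le (v := u) (c := g) (r := partialDeriv j ϑ) (w := partialDeriv j u) (x := x) (j := k)
      (hu.partialDeriv j) (hM k).2.1 (Hg.one k)
    have h1 : Fintype.card d * (M₁ * dsize₁ (partialDeriv j ϑ) x) + C * vsize₁ (partialDeriv j u) x ≤
        Fintype.card d * (M₁ * s₂) + C * s₂ := by gcongr
    have t1 := mul_le_mul_of_nonneg_right qnM hs₂0
    have t3 := mul_le_mul_of_nonneg_right qC hs₂0
    rw [hK]; linarith

include hu hϑ hg hM0 hC hM hs₂ hs₃ Hg in
/-- **Temperature equation, level 3**. [cite: Majda1984, Ch. 2 §2.1, proof of Thm 2.1] -/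
theorem temp_level₃ (j k l : d) :
    |partialDeriv l (partialDeriv k (tcont u g ϑ u j)) x| ≤ levelConst d C M₁ * (1 + s₂ + s₃ + s₂ * s₂) ∧
    |partialDeriv l (tcont u g (partialDeriv j ϑ) (partialDeriv j u) k) x| ≤
      levelConst d C M₁ * (1 + s₂ + s₃ + s₂ * s₂) ∧
    |tcont u g (partialDeriv k (partialDeriv j ϑ)) (partialDeriv k (partialDeriv j u)) l x| ≤
      levelConst d C M₁ * (1 + s₂ + s₃ + s₂ * s₂) := by
  obtain ⟨-, d1u, d1ϑ, -, d2u, d2ϑ, -, d3u, d3ϑ, hs₂0, hs₃0⟩ := sizes_le hM hs₂ hs₃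
  obtain ⟨u2, u3, -, -, -, -⟩ := second_third_le hM hs₂ hs₃
  obtain ⟨hP0, hP1, h2, hn, qM, qC, qnM, qnnM, q2n, q2C, -, qCnM, -, -, -, -⟩ := level_prelim (d := d) hM0 hC
  set P4 := (((Fintype.card d : ℝ) + 1) * (C + 1) * (M₁ + 1)) ^ 4 with hP4
  have hK : levelConst d C M₁ = 12 * P4 := rfl
  have hC0 : 0 ≤ C := by linarith
  have hA1 : 0 ≤ C * (1 + s₂) := by positivity
  have hA2 : 0 ≤ C * (1 + s₂ + s₃) := by positivity
  have hss : 0 ≤ s₂ * s₂ := mul_nonneg hs₂0 hs₂0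
  have hPs₂ : 0 ≤ P4 * s₂ := mul_nonneg hP0 hs₂0
  have hPs₃ : 0 ≤ P4 * s₃ := mul_nonneg hP0 hs₃0
  have hPss : 0 ≤ P4 * (s₂ * s₂) := mul_nonneg hP0 hss
  refine ⟨?_, ?_, ?_⟩
  · have h0 := abs_partialDeriv₂_tcont_le (v := u) (c := g) (r := ϑ) (w := u) (x := x) (j := j) hu hg hϑ hu
      (hM j).2.1 (u2 j) (u3 j) (Hg.one j) (fun k' => Hg.two j k') (fun k' l' => Hg.three j k' l') k l
    have h1 : Fintype.card d * (M₁ * dsize₃ ϑ x + 2 * (s₂ * dsize₂ ϑ x) + s₃ * dsize₁ ϑ x) +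
        (C * vsize₃ u x + 2 * (C * (1 + s₂) * vsize₂ u x) + C * (1 + s₂ + s₃) * vsize₁ u x) ≤
        Fintype.card d * (M₁ * s₃ + 2 * (s₂ * s₂) + s₃ * (Fintype.card d * M₁)) +
        (C * s₃ + 2 * (C * (1 + s₂) * s₂) + C * (1 + s₂ + s₃) * (Fintype.card d * M₁)) := by
      gcongr
    have t1 := mul_le_mul_of_nonneg_right qnM hs₃0
    have t2 := mul_le_mul_of_nonneg_right q2n hss
    have t3 := mul_le_mul_of_nonneg_right qnnM hs₃0
    have t4 := mul_le_mul_of_nonneg_right qC hs₃0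
    have t5 := mul_le_mul_of_nonneg_right q2C hs₂0
    have t6 := mul_le_mul_of_nonneg_right q2C hss
    have t7 := mul_le_mul_of_nonneg_right qCnM hs₂0
    have t8 := mul_le_mul_of_nonneg_right qCnM hs₃0
    rw [hK]; linarith
  · have hθ1 : dsize₁ (partialDeriv j ϑ) x ≤ s₂ := (dsize₁_partialDeriv_le hϑ x j).trans d2ϑ
    have hθ2 : dsize₂ (partialDeriv j ϑ) x ≤ s₃ := (dsize₂_partialDeriv_le hϑ x j).trans d3ϑ
    have hw1 : vsize₁ (partialDeriv j u) x ≤ s₂ := (vsize₁_partialDeriv_le hu x j).trans d2u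
    have hw2 : vsize₂ (partialDeriv j u) x ≤ s₃ := (vsize₂_partialDeriv_le hu x j).trans d3u
    have h0 := abs_partialDeriv_tcont_le (v := u) (c := g) (r := partialDeriv j ϑ) (w := partialDeriv j u)
      (x := x) (j := k) hu hg (hϑ.partialDeriv j) (hu.partialDeriv j) (hM k).2.1 (u2 k) (Hg.one k)
      (fun k' => Hg.two k k') l
    have h1 : Fintype.card d * (M₁ * dsize₂ (partialDeriv j ϑ) x + s₂ * dsize₁ (partialDeriv j ϑ) x) +
        (C * vsize₂ (partialDeriv j u) x + C * (1 + s₂) * vsize₁ (partialDeriv j u) x) ≤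
        Fintype.card d * (M₁ * s₃ + s₂ * s₂) + (C * s₃ + C * (1 + s₂) * s₂) := by gcongr
    have t1 := mul_le_mul_of_nonneg_right qnM hs₃0
    have t2 := mul_le_mul_of_nonneg_right hn hss
    have t3 := mul_le_mul_of_nonneg_right qC hs₃0
    have t4 := mul_le_mul_of_nonneg_right qC hs₂0
    have t5 := mul_le_mul_of_nonneg_right qC hss
    rw [hK]; linarith
  · have hθ1 : dsize₁ (partialDeriv k (partialDeriv j ϑ)) x ≤ s₃ := (dsize₁_partialDeriv₂_le hϑ x j k).trans d3ϑ
    have hw1 : vsize₁ (partialDeriv k (partialDeriv j u)) x ≤ s₃ := (vsize₁_partialDeriv₂_le hu x j k).trans d3u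
    have h0 := abs_tcont_le (v := u) (c := g) (r := partialDeriv k (partialDeriv j ϑ))
      (w := partialDeriv k (partialDeriv j u)) (x := x) (j := l) ((hu.partialDeriv j).partialDeriv k) (hM l).2.1 (Hg.one l)
    have h1 : Fintype.card d * (M₁ * dsize₁ (partialDeriv k (partialDeriv j ϑ)) x) +
        C * vsize₁ (partialDeriv k (partialDeriv j u)) x ≤ Fintype.card d * (M₁ * s₃) + C * s₃ := by gcongr
    have t1 := mul_le_mul_of_nonneg_right qnM hs₃0
    have t3 := mul_le_mul_of_nonneg_right qC hs₃0
    rw [hK]; linarith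

end Levels

end CompressibleEuler

end Literature.Analysis.FluidPDE

end
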